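import Mathlib.NumberTheory.LSeries.DirichletContinuation
import Mathlib.NumberTheory.DirichletCharacter.Orthogonality
import Mathlib.NumberTheory.GaussSum
import Mathlib.NumberTheory.ArithmeticFunction.Moebius
import Mathlib.Analysis.SpecialFunctions.Complex.CircleAddChar
import Mathlib.Analysis.SpecialFunctions.Pow.Real
import Mathlib.Analysis.Calculus.ContDiff.Defs
import Mathlib.Algebra.Order.BigOperators.Ring.Finset
import Mathlib.Data.Nat.Totient
import HarnessLib

/-!
# Optimality of mollifiers (Čech–Matomäki 2025): the general comparison criteria (proved) and
# the optimality of the Iwaniec–Sarnak and Michel–VanderKam mollifiers (named facts)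

Topic `Literature/NumberTheory/LFunctions` (namespace `Literature.NumberTheory.LFunctions`).
Typed for the LANDAU–SIEGEL PROGRAMME (cell `landau-siegel`, §C literature harvest, topic r4
"mollifier technology"; HOME/lit/r4/ROWS.md row R4-01). STATEMENT LAYER in the sense of D-0014:
sorry-free; the elementary §2 results are PROVED, the two analytic theorems are NAMED `Prop` FACTS
(nothing asserted). The programme SEARCHES and TYPES; no claim about Landau–Siegel zeros is made
here.

## Source

M. Čech, K. Matomäki, *On optimality of mollifiers*, arXiv:2501.12526 (v1 2025-01-21, v3
2025-10-17) [bib: `CechMatomaki2025`]. Locators `§n` / `Thm n.m` refer to that text (read via the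
TeX source, 2026-08-26).

## What is printed and what is typed

**§2 "General results" (PROVED below, `CechMatomaki2025.General`).** A finite family `G`, a
non-negative weight `w` (not identically zero), objects `L : G → ℂ`, mollifiers `M, N : G → ℂ`;
`Ψ_M := 𝔼^w[L M]`, `Ψ_{M,N} := 𝔼^w[L M · conj(L N)]`, `𝔼^w f := Σ w f / Σ w`;
`β(M) := |Ψ_M|² / Ψ_{M,M}` (`:= 0` if `Ψ_{M,M} = 0`). Printed and proved here:
* the Cauchy–Schwarz facts `|Ψ_M|² ≤ 𝔼^w[1_{L ≠ 0}] · Ψ_{M,M}` (eq. (2.1), "the (weighted)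
  non-vanishing proportion is at least `β(M)`") and `|Ψ_{M,N}|² ≤ Ψ_{M,M} Ψ_{N,N}`;
* **Theorem 2.4** (criterion): `δ ∈ [0, 1/10)`, `Ψ_{M,M} ≠ 0`,
  `|Ψ_M Ψ_{M,N}| ≥ (1 − δ)|Ψ_N| Ψ_{M,M}` ⇒ `β(N) ≤ (1 + 4δ) β(M)`;
* the sesquilinear bookkeeping `Ψ_{M+αN} = Ψ_M + αΨ_N`,
  `Ψ_{M+αN,M+αN} = Ψ_{M,M} + 2 Re(conj(α) Ψ_{M,N}) + |α|² Ψ_{N,N}` (display before Thm 2.5);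
* **Corollary 2.6 (ii)**: `Ψ_M conj(Ψ_{M,N}) = Ψ_N Ψ_{M,M}` (and `Ψ_{M,M} ≠ 0`) ⇒
  `β(M + αN) ≤ β(M)` for every `α ∈ ℂ` (proved here directly from Cauchy–Schwarz; the paper
  deduces it from Theorem 2.5);
* **Lemma 3.1** (`lemma31`) and **Theorem 2.5 (i)** (`theorem25i`): `β(M) ≥ β(N)`,
  `Ψ_M Ψ_{N,N} ≠ 0`, `Ψ_N Ψ_{M,N} = Ψ_M Ψ_{N,N}` ⇒ `|Ψ_N|²Ψ_{M,M} = |Ψ_M|²Ψ_{N,N}`,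
  `Ψ_N Ψ_{M,M} = Ψ_M conj(Ψ_{M,N})`, and `β(M + αN) = β(M)` for every `α ≠ −Ψ_M/Ψ_N`
  (appended 2026-08-26, following the printed proof);
* **Corollary 2.6 (i)** (`corollary26i`), **Corollary 2.7** (`corollary27`, converse of the criterion
  in an additive class), **Corollary 2.8 (i)/(ii)** (`corollary28i`: `β(M+α₁N) − β(M) ≥ δ⁴β(N)`;
  `corollary28ii`: `≤ δ²β(N)/β(M) ≤ δ²`), **Lemma 3.3** (`lemma33`, quantitative Cauchy–Schwarz for
  `M − (Ψ_{M,N}/Ψ_{N,N})N`) and **Corollary 2.10 (i)/(ii)** (`corollary210`, `corollary210ii`: the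
  inefficient-second-piece dichotomy `≥ (δ/4)β(M)` / `≤ 5δβ(M)`), all PROVED from Theorem 2.5 (ii)
  (appended 2026-08-26). With these, every numbered result of §2 of the paper is a theorem here.
**Theorem 2.5 (ii)** (the optimal `α₁` and the value `β(M + α₁N) = β(M) + |Ψ̄_MΨ_{M,N} −
Ψ̄_NΨ_{M,M}|²/(Ψ_{M,M}(Ψ_{M,M}Ψ_{N,N} − |Ψ_{M,N}|²))`, a maximum over `α ∈ ℂ`) is typed as the
named fact `cechMatomaki2025_theorem25ii` and DISCHARGED (`cechMatomaki2025_theorem25ii_holds`,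
appended 2026-08-26: a Gram-matrix/Lagrange-identity form of the printed case analysis, with
Lemma 3.3 (i)–(ii) proved inline).

**Propositions 4.1–4.2** (§4, the four mollified moments behind Theorem 1.1 — first moments of a
general one-piece `N` (`θ < 1`) and of `M_IS`, the correlation `Ψ_{M_IS,N}` with any shorter general `N`,
and `Ψ_{M_IS,M_IS}`; sums over even primitive characters, `PsiPlus`/`Psi2Plus`) are typed as the
named facts `cechMatomaki2025_proposition41i/41ii/42i/42ii` (appended 2026-08-26; bookkeeping
`log_div_log_rpow`, `isValue_of_mainTerms` proved).

**Theorem 1.1** (`cechMatomaki2025_theorem11`, NAMED FACT). `θ < 1/2`, `q ≥ 3`;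
`M_IS(χ) = Σ_{b ≤ q^θ} μ(b)χ(b)b^{−1/2}(1 − log b / log q^θ)` (Iwaniec–Sarnak);
`N_G(χ) = Σ_{b ≤ q^θ} x_b χ(b) b^{−1/2}`, `x_b ∈ ℂ` arbitrary with `x_1 = 1` and `x_b ≪ q^ε` for
every `ε > 0`; `β_q(M) := |Σ*_χ L(1/2,χ)M(χ)|² / Σ*_χ |L(1/2,χ)M(χ)|²` over primitive `χ mod q`
(`Σ*` the NORMALISED average over primitive characters — see "Rendering choices").
Then "`β_q(N_G) ≤ β_q(M_IS) + o(1) = 1/(1 + 1/θ) + o(1)`."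

**Theorem 1.3** (`cechMatomaki2025_theorem13`, NAMED FACT). `θ < 1/2`; `Φ ≥ 0` smooth,
`supp Φ ⊂ [1/2, 2]`, `Φ(1) ≥ 1`; `β_Q(M) := |Σ_q Φ(q/Q)(q/φ(q)) Σ*_χ L(1/2,χ)M(χ)|² /
Σ_q Φ(q/Q)(q/φ(q)) Σ*_χ |L(1/2,χ)M(χ)|²` (normalised likewise); `M_MV` = the balanced Michel–VanderKam mollifier of
length `Q^θ` (second piece twisted by `conj(ε_χ)`, `ε_χ` the normalised Gauss sum); `N_B` = a
general "Bui-type" mollifier `Σ_{ab ≤ Q^θ} x_{a,b} χ̄(a)χ(b)(ab)^{−1/2} + conj(ε_χ) Σ_{ab ≤ Q^θ}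
y_{a,b} χ(a)χ̄(b)(ab)^{−1/2}` with real coefficients and `z := x + y` subject to (a) `z_{a,b} ≪_ε Q^ε`,
(b) `Σ_{ab ≤ Q^θ} |z_{a,b}|²/(ab) ≪ exp(c (log Q)^{3/5}(log log Q)^{−1/5})`, (c) `Σ_q Φ(q/Q)
(qφ⁺(q)/φ(q)) Σ_{k²b ≤ Q^θ, (kb,q)=1} z_{kb,k}/(kb) ≍ Q²`. Then for every `ε₁ > 0` there is
`c = c(ε₁) > 0` with "`β_Q(N_B) ≤ β_Q(M_MV) + ε₁ = 1/(1 + 1/(2θ)) + ε₁ + o(1)`"; under a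
quasi-Riemann hypothesis (b) is not needed (not typed).

## Rendering choices (read before citing)

* NORMALISATION of `β` (v2 of this file; the first accepted version typed the §1 displays with raw
  sums, which made Theorems 1.1/1.3 false as typed — erratum by ls-lit-r5, cell landau-siegel
  INBOX 2026-08-26T15:35Z): `β_q` and `β_Q` ARE the §2 quantity `β(M) = |Ψ_M|²/Ψ_{M,M}` with
  NORMALISED averages `Ψ = 𝔼^w` (Example 2.1: `G` = primitive characters, `L(χ) = L(1/2, χ)`;
  for `β_Q` the weight `w(q,χ) = Φ(q/Q) q/φ(q)`), i.e. the §1 ratios divided by the total weight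
  (`φ*(q)` resp. `Σ_q Φ(q/Q)(q/φ(q))φ*(q)`). Only so are they proportions `≤ 1` (`betaMod_le_one`,
  `betaAvg_le_one`, proved) and only so can (1.2) read "`= 1/(1+1/θ) + o(1)`". They are DEFINED
  through the general `beta` of §2, so every proved §2 statement applies to them verbatim.
* `Σ_{q ≥ 1} Φ(q/Q) …` is an infinite sum in print but `Φ(q/Q) = 0` unless `Q/2 ≤ q ≤ 2Q`; the
  family is typed over the moduli `1 ≤ q ≤ ⌊2Q⌋`, which gives the same numbers. Terms needing
  `[NeZero q]` (`L(1/2, χ)`, `ε_χ`) are defined through `if q = 0 then 0 else …`; only `q ≥ 1` occurs.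
  Theorem 1.1 (i) is stated along moduli `q ≢ 2 (mod 4)` (those admitting primitive characters;
  for `q ≡ 2 (mod 4)`, `β_q = 0` and the printed "`q ≥ 3`" asymptotic is read along admissible `q`).
* `≪_ε`, `≪`, `≍`, `o(1)`: as in `TwistedSecondMomentPrimeModulus.lean`, the implied-constant data
  (a growth budget `C : ℝ → ℝ`, `ε ↦ C_ε`; constants `C_b`, `c₁ ≤ c₂`) are fixed FIRST, then the
  threshold (`q₀`/`Q₀`) may depend on them and on `θ, Φ, ε₁, ε₂`; the `o(1)` is rendered as
  "`≤ … + ε₂` for every `ε₂ > 0` and all large `q`/`Q`", uniformly over the admissible coefficients.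
  The printed "`β(N) ≤ β(M) + o(1) = value + o(1)`" is typed as the pair (limit of `β(M)`) ∧
  (uniform upper bound `value + o(1)` for `β(N)`), which is equivalent.
* `θ > 0` is implicit in print (`q^θ`, `1/θ`); typed `0 < θ < 1/2`. Primitive characters: Mathlib's
  `DirichletCharacter.IsPrimitive`; `L(1/2, χ)`: Mathlib's `DirichletCharacter.LFunction χ (1/2)`;
  `μ`: `ArithmeticFunction.moebius`; `ε_χ := τ(χ)/√q` with `τ(χ) = Σ_t χ(t) e(t/q)`
  (`gaussSum χ ZMod.stdAddChar`), the normalisation of §6.1 of the source.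
* Thm 1.3 (c) uses `φ⁺(q)` = number of EVEN primitive characters (as printed), while `β_Q` sums
  over all primitive characters (as printed in §1; the proofs "concentrate on even primitive
  characters … Odd characters can be handled similarly", §4/§5).

WHAT THIS IS NOT: not a claim that any mollifier breaks the `1/2` proportion; Theorem 1.3 is the
printed statement that, on average over `q`, no balanced Bui-type two-piece mollifier does better
than Michel–VanderKam's `1/(1+1/(2θ)) ≤ 1/2` (and hence that the strategy of the published version
of Pratt, ANT 13 (2019) — withdrawn by its author, arXiv:1804.01445v2 — cannot work). STATUS of the
named facts `cechMatomaki2025_theorem11`, `_theorem13`, `_proposition41i`, `_proposition41ii`,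
`_proposition42i`, `_proposition42ii`: preprint claims, unrefereed (arXiv:2501.12526, zbMATH «Preprint» at
2026-08), tagged `[claim: CechMatomaki2025, status: under-review]` per fact (cell landau-siegel REF-C request
2026-08-26T22:14:30Z); the §2 optimality theory as typed here (Theorem 2.4 `criterion`, Theorem 2.5,
Corollaries 2.6 (i), 2.7, 2.8, 2.10, Lemmas 3.1, 3.3) is PROVED in the kernel from the definitions and carries
no claim.

## References
* [CechMatomaki2025] §1 Theorems 1.1, 1.3, Remark 1.2; §2 Theorems 2.4, 2.5, Corollaries 2.6–2.10,
  Remark 2.2; §3 (proofs of §2, Lemmas 3.1, 3.3); §4 (4.1)–(4.2), Propositions 4.1, 4.2; §6.1 (root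
  numbers); §10 (the unbalanced case).
-/

noncomputable section

open Finset
open scoped ComplexConjugate ContDiff

namespace Literature.NumberTheory.LFunctions

namespace CechMatomaki2025

/-! ## §2 General results — definitions -/

section General

variable {ι : Type*} [Fintype ι] (w : ι → ℝ) (L : ι → ℂ)

/-- Total weight `Σ_π w(π)` of the family. [cite: CechMatomaki2025, §2] -/
def totalWeight : ℝ := ∑ π, w π

/-- `Ψ_M := 𝔼^w_π L(π) M(π) = (Σ w L M) / (Σ w)`. [cite: CechMatomaki2025, §2] -/
def Psi (M : ι → ℂ) : ℂ := (∑ π, (w π : ℂ) * (L π * M π)) / (totalWeight w : ℂ)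

/-- `Ψ_{M,N} := 𝔼^w_π L(π)M(π) · conj(L(π)N(π))`. [cite: CechMatomaki2025, §2] -/
def Psi2 (M N : ι → ℂ) : ℂ :=
  (∑ π, (w π : ℂ) * (L π * M π * conj (L π * N π))) / (totalWeight w : ℂ)

/-- The real number `Ψ_{M,M} = 𝔼^w |L M|²` (see `Psi2_self`). [cite: CechMatomaki2025, §2] -/
def msq (M : ι → ℂ) : ℝ := (∑ π, w π * ‖L π * M π‖ ^ 2) / totalWeight w

/-- `β(M) := |Ψ_M|² / Ψ_{M,M}`, with `β(M) = 0` when `Ψ_{M,M} = 0` (division by zero is zero).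
[cite: CechMatomaki2025, §2] -/
def beta (M : ι → ℂ) : ℝ := ‖Psi w L M‖ ^ 2 / msq w L M

open scoped Classical in
/-- The weighted proportion of non-vanishing `𝔼^w_π 1_{L(π) ≠ 0}`. [cite: CechMatomaki2025, §2 (2.1)] -/
def nonvanishingProportion : ℝ := (∑ π, if L π = 0 then 0 else w π) / totalWeight w

/-! ## §2 General results — proofs -/

variable {w L}

/-- The total weight of a non-negative weight is non-negative ("`w` is a non-negative weight
function"). [cite: CechMatomaki2025, §2] -/
theorem totalWeight_nonneg (hw : ∀ π, 0 ≤ w π) : 0 ≤ totalWeight w :=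
  sum_nonneg fun π _ => hw π

/-- `Ψ_{M,M} ≥ 0`. [cite: CechMatomaki2025, §2] -/
theorem msq_nonneg (hw : ∀ π, 0 ≤ w π) (M : ι → ℂ) : 0 ≤ msq w L M :=
  div_nonneg (sum_nonneg fun π _ => mul_nonneg (hw π) (sq_nonneg _)) (totalWeight_nonneg hw)

/-- `β(M) ≥ 0`. [cite: CechMatomaki2025, §2] -/
theorem beta_nonneg (hw : ∀ π, 0 ≤ w π) (M : ι → ℂ) : 0 ≤ beta w L M :=
  div_nonneg (sq_nonneg _) (msq_nonneg hw M)

/-- `Ψ_{M,M}` is the real number `𝔼^w |L M|²`. [cite: CechMatomaki2025, §2] -/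
theorem Psi2_self (M : ι → ℂ) : Psi2 w L M M = (msq w L M : ℂ) := by
  unfold Psi2 msq
  push_cast
  congr 1
  refine sum_congr rfl fun π _ => ?_
  rw [Complex.mul_conj, Complex.normSq_eq_norm_sq]
  push_cast
  ring

/-- `Ψ_{N,M} = conj Ψ_{M,N}`. [cite: CechMatomaki2025, §2] -/
theorem Psi2_swap (M N : ι → ℂ) : Psi2 w L N M = conj (Psi2 w L M N) := by
  unfold Psi2
  rw [map_div₀, Complex.conj_ofReal, map_sum]
  congr 1
  refine sum_congr rfl fun π _ => ?_
  simp only [map_mul, Complex.conj_ofReal, Complex.conj_conj]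
  ring

omit [Fintype ι] in
/-- Termwise size of the second-moment summand `|w · LM · conj(LN)| = w |LM| |LN|` (a step of the
Cauchy–Schwarz computations of §3). [cite: CechMatomaki2025, §3 (proof of Theorem 2.4)] -/
private theorem norm_term (hw : ∀ π, 0 ≤ w π) (M N : ι → ℂ) (π : ι) :
    ‖(w π : ℂ) * (L π * M π * conj (L π * N π))‖ = w π * (‖L π * M π‖ * ‖L π * N π‖) := by
  rw [norm_mul, norm_mul, Complex.norm_real, Real.norm_of_nonneg (hw π), Complex.norm_conj]

/-- **Cauchy–Schwarz for the mollified moments**: `|Ψ_{M,N}|² ≤ Ψ_{M,M} Ψ_{N,N}`.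
[cite: CechMatomaki2025, §2 (display after Example 2.1)] -/
theorem norm_Psi2_sq_le (hw : ∀ π, 0 ≤ w π) (M N : ι → ℂ) :
    ‖Psi2 w L M N‖ ^ 2 ≤ msq w L M * msq w L N := by
  by_cases hW : totalWeight w = 0
  · simp [Psi2, msq, hW]
  have hWpos : 0 < totalWeight w := lt_of_le_of_ne (totalWeight_nonneg hw) (Ne.symm hW)
  -- the numerator sums
  set A : ℝ := ∑ π, w π * (‖L π * M π‖ * ‖L π * N π‖) with hA
  set F : ℝ := ∑ π, w π * ‖L π * M π‖ ^ 2 with hF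
  set G : ℝ := ∑ π, w π * ‖L π * N π‖ ^ 2 with hG
  have h1 : ‖∑ π, (w π : ℂ) * (L π * M π * conj (L π * N π))‖ ≤ A := by
    refine (norm_sum_le _ _).trans (le_of_eq ?_)
    exact sum_congr rfl fun π _ => norm_term hw M N π
  have h2 : A ^ 2 ≤ F * G := by
    refine sum_sq_le_sum_mul_sum_of_sq_le_mul univ (fun π _ => ?_) (fun π _ => ?_) (fun π _ => ?_)
    · exact mul_nonneg (hw π) (sq_nonneg _)
    · exact mul_nonneg (hw π) (sq_nonneg _)
    · exact le_of_eq (by ring)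
  have hA0 : 0 ≤ A := sum_nonneg fun π _ => mul_nonneg (hw π) (mul_nonneg (norm_nonneg _) (norm_nonneg _))
  have hnorm : ‖Psi2 w L M N‖ = ‖∑ π, (w π : ℂ) * (L π * M π * conj (L π * N π))‖ / totalWeight w := by
    rw [Psi2, norm_div, Complex.norm_real, Real.norm_of_nonneg hWpos.le]
  rw [hnorm, div_pow, msq, msq, ← hF, ← hG, div_mul_div_comm, ← sq]
  gcongr
  calc ‖∑ π, (w π : ℂ) * (L π * M π * conj (L π * N π))‖ ^ 2 ≤ A ^ 2 := by gcongr
    _ ≤ F * G := h2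

/-- **The mollifier principle (Cauchy–Schwarz, eq. (2.1))**:
`|Ψ_M|² ≤ 𝔼^w[1_{L ≠ 0}] · Ψ_{M,M}`, i.e. the weighted proportion of `π` with `L(π) ≠ 0` is at
least `β(M)` whenever `Ψ_{M,M} ≠ 0`. [cite: CechMatomaki2025, §2 (2.1)] -/
theorem norm_Psi_sq_le (hw : ∀ π, 0 ≤ w π) (M : ι → ℂ) :
    ‖Psi w L M‖ ^ 2 ≤ nonvanishingProportion w L * msq w L M := by
  classical
  by_cases hW : totalWeight w = 0
  · simp [Psi, msq, hW]
  have hWpos : 0 < totalWeight w := lt_of_le_of_ne (totalWeight_nonneg hw) (Ne.symm hW)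
  set A : ℝ := ∑ π, w π * ‖L π * M π‖ with hA
  set F : ℝ := ∑ π, (if L π = 0 then 0 else w π) with hF
  set G : ℝ := ∑ π, w π * ‖L π * M π‖ ^ 2 with hG
  have h1 : ‖∑ π, (w π : ℂ) * (L π * M π)‖ ≤ A := by
    refine (norm_sum_le _ _).trans (le_of_eq (sum_congr rfl fun π _ => ?_))
    rw [norm_mul, Complex.norm_real, Real.norm_of_nonneg (hw π)]
  have h2 : A ^ 2 ≤ F * G := by
    refine sum_sq_le_sum_mul_sum_of_sq_le_mul univ (fun π _ => ?_) (fun π _ => ?_) (fun π _ => ?_)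
    · split_ifs
      · exact le_rfl
      · exact hw π
    · exact mul_nonneg (hw π) (sq_nonneg _)
    · by_cases hL : L π = 0
      · simp [hL]
      · simp only [hL, if_false]
        exact le_of_eq (by ring)
  have hnorm : ‖Psi w L M‖ = ‖∑ π, (w π : ℂ) * (L π * M π)‖ / totalWeight w := by
    rw [Psi, norm_div, Complex.norm_real, Real.norm_of_nonneg hWpos.le]
  rw [hnorm, div_pow, nonvanishingProportion, msq, ← hF, ← hG, div_mul_div_comm, ← sq]
  gcongr
  calc ‖∑ π, (w π : ℂ) * (L π * M π)‖ ^ 2 ≤ A ^ 2 := by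
        have hA0 : 0 ≤ A := sum_nonneg fun π _ => mul_nonneg (hw π) (norm_nonneg _)
        gcongr
    _ ≤ F * G := h2

/-- The non-vanishing proportion is at least `β(M)` (the form in which (2.1) is used).
[cite: CechMatomaki2025, §2 (2.1)] -/
theorem beta_le_nonvanishingProportion (hw : ∀ π, 0 ≤ w π) (M : ι → ℂ) :
    beta w L M ≤ nonvanishingProportion w L := by
  unfold beta
  by_cases hm : msq w L M = 0
  · rw [hm, div_zero]
    exact div_nonneg (sum_nonneg fun π _ => by split_ifs <;> [exact le_rfl; exact hw π])
      (totalWeight_nonneg hw)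
  · have hmpos : 0 < msq w L M := lt_of_le_of_ne (msq_nonneg hw M) (Ne.symm hm)
    rw [div_le_iff₀ hmpos]
    exact norm_Psi_sq_le hw M

/-- **Theorem 2.4 (the criterion).** `δ ∈ [0, 1/10)`, `Ψ_{M,M} ≠ 0` and
`|Ψ_M Ψ_{M,N}| ≥ (1 − δ) |Ψ_N| Ψ_{M,M}` imply `β(N) ≤ (1 + 4δ) β(M)`.
[cite: CechMatomaki2025, Theorem 2.4] -/
theorem criterion (hw : ∀ π, 0 ≤ w π) {δ : ℝ} (hδ₀ : 0 ≤ δ) (hδ : δ < 1 / 10) {M N : ι → ℂ}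
    (hMM : msq w L M ≠ 0)
    (h : (1 - δ) * (‖Psi w L N‖ * msq w L M) ≤ ‖Psi w L M * Psi2 w L M N‖) :
    beta w L N ≤ (1 + 4 * δ) * beta w L M := by
  have hMpos : 0 < msq w L M := lt_of_le_of_ne (msq_nonneg hw M) (Ne.symm hMM)
  have hβM : 0 ≤ beta w L M := beta_nonneg hw M
  by_cases hNN : msq w L N = 0
  · simp only [beta, hNN, div_zero]
    exact mul_nonneg (by linarith) hβM
  have hNpos : 0 < msq w L N := lt_of_le_of_ne (msq_nonneg hw N) (Ne.symm hNN)
  -- square the hypothesis and use Cauchy–Schwarz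
  have hCS : ‖Psi2 w L M N‖ ^ 2 ≤ msq w L M * msq w L N := norm_Psi2_sq_le hw M N
  have h0 : 0 ≤ (1 - δ) * (‖Psi w L N‖ * msq w L M) :=
    mul_nonneg (by linarith) (mul_nonneg (norm_nonneg _) hMpos.le)
  have hsq : ((1 - δ) * (‖Psi w L N‖ * msq w L M)) ^ 2 ≤ ‖Psi w L M‖ ^ 2 * ‖Psi2 w L M N‖ ^ 2 := by
    rw [← mul_pow, ← norm_mul]
    exact pow_le_pow_left₀ h0 h 2
  have key : (1 - δ) ^ 2 * ‖Psi w L N‖ ^ 2 * msq w L M ≤ ‖Psi w L M‖ ^ 2 * msq w L N := by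
    have h3 : ((1 - δ) * (‖Psi w L N‖ * msq w L M)) ^ 2 ≤
        ‖Psi w L M‖ ^ 2 * (msq w L M * msq w L N) :=
      hsq.trans (mul_le_mul_of_nonneg_left hCS (sq_nonneg _))
    have h4 : ((1 - δ) ^ 2 * ‖Psi w L N‖ ^ 2 * msq w L M) * msq w L M ≤
        (‖Psi w L M‖ ^ 2 * msq w L N) * msq w L M := by nlinarith [h3]
    exact le_of_mul_le_mul_right h4 hMpos
  have hpoly : 1 ≤ (1 + 4 * δ) * (1 - δ) ^ 2 := by
    have h1 : 0 ≤ 2 - 7 * δ + 4 * δ ^ 2 := by nlinarith [sq_nonneg δ, hδ, hδ₀]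
    have h2 : 0 ≤ δ * (2 - 7 * δ + 4 * δ ^ 2) := mul_nonneg hδ₀ h1
    have h3 : (1 + 4 * δ) * (1 - δ) ^ 2 = 1 + δ * (2 - 7 * δ + 4 * δ ^ 2) := by ring
    linarith
  -- the cleared-denominator form: ‖Ψ_N‖² · msq M ≤ (1+4δ) ‖Ψ_M‖² msq N
  have hx : 0 ≤ ‖Psi w L N‖ ^ 2 * msq w L M := mul_nonneg (sq_nonneg _) hMpos.le
  have h14 : (0 : ℝ) ≤ 1 + 4 * δ := by linarith
  have hgoal : ‖Psi w L N‖ ^ 2 * msq w L M ≤ (1 + 4 * δ) * ‖Psi w L M‖ ^ 2 * msq w L N :=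
    calc ‖Psi w L N‖ ^ 2 * msq w L M
        ≤ ((1 + 4 * δ) * (1 - δ) ^ 2) * (‖Psi w L N‖ ^ 2 * msq w L M) :=
          le_mul_of_one_le_left hx hpoly
      _ = (1 + 4 * δ) * ((1 - δ) ^ 2 * ‖Psi w L N‖ ^ 2 * msq w L M) := by ring
      _ ≤ (1 + 4 * δ) * (‖Psi w L M‖ ^ 2 * msq w L N) := mul_le_mul_of_nonneg_left key h14
      _ = (1 + 4 * δ) * ‖Psi w L M‖ ^ 2 * msq w L N := by ring
  unfold beta
  rw [div_le_iff₀ hNpos]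
  calc ‖Psi w L N‖ ^ 2 = ‖Psi w L N‖ ^ 2 * msq w L M / msq w L M :=
        (eq_div_iff hMpos.ne').mpr rfl
    _ ≤ (1 + 4 * δ) * ‖Psi w L M‖ ^ 2 * msq w L N / msq w L M := by gcongr
    _ = (1 + 4 * δ) * (‖Psi w L M‖ ^ 2 / msq w L M) * msq w L N := by ring

/-! ### Combined mollifiers `M + α N` -/

/-- `Ψ_{M + αN} = Ψ_M + α Ψ_N`. [cite: CechMatomaki2025, §2 (display before Theorem 2.5)] -/
theorem Psi_add_smul (M N : ι → ℂ) (α : ℂ) :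
    Psi w L (M + α • N) = Psi w L M + α * Psi w L N := by
  unfold Psi
  rw [mul_div_assoc', ← add_div]  -- both sides over `totalWeight`
  congr 1
  rw [mul_sum, ← sum_add_distrib]
  refine sum_congr rfl fun π _ => ?_
  simp only [Pi.add_apply, Pi.smul_apply, smul_eq_mul]
  ring

/-- `Ψ_{M+αN, M+αN} = Ψ_{M,M} + 2 Re(conj(α) Ψ_{M,N}) + |α|² Ψ_{N,N}` (as real numbers).
[cite: CechMatomaki2025, §2 (display before Theorem 2.5)] -/
theorem msq_add_smul (M N : ι → ℂ) (α : ℂ) :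
    msq w L (M + α • N) = msq w L M + 2 * (conj α * Psi2 w L M N).re + ‖α‖ ^ 2 * msq w L N := by
  -- compare the complex numbers `Ψ2 (M+αN) (M+αN)` expanded by sesquilinearity
  have hnorm : ((‖α‖ ^ 2 : ℝ) : ℂ) = α * conj α := by
    rw [Complex.ofReal_pow, ← Complex.mul_conj']
  have hC : (msq w L (M + α • N) : ℂ) =
      (msq w L M : ℂ) + (conj α * Psi2 w L M N + α * conj (Psi2 w L M N)) +
        ((‖α‖ ^ 2 : ℝ) : ℂ) * (msq w L N : ℂ) := by
    rw [hnorm, ← Psi2_self, ← Psi2_self, ← Psi2_self, ← Psi2_swap]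
    unfold Psi2
    simp only [mul_div_assoc', ← add_div]
    congr 1
    rw [mul_sum, mul_sum, mul_sum, ← sum_add_distrib, ← sum_add_distrib, ← sum_add_distrib]
    refine sum_congr rfl fun π _ => ?_
    simp only [Pi.add_apply, Pi.smul_apply, smul_eq_mul, map_mul, map_add]
    ring
  have hre : (conj α * Psi2 w L M N).re + (α * conj (Psi2 w L M N)).re =
      2 * (conj α * Psi2 w L M N).re := by
    have : α * conj (Psi2 w L M N) = conj (conj α * Psi2 w L M N) := by
      rw [map_mul, Complex.conj_conj]
    rw [this, Complex.conj_re]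
    ring
  have hR := congrArg Complex.re hC
  simp only [Complex.add_re, Complex.ofReal_re, Complex.re_ofReal_mul] at hR
  rw [hR, hre]

/-- **Corollary 2.6 (ii)** (no multiple of `N` improves `M`): if `Ψ_{M,M} ≠ 0` and
`Ψ_M conj(Ψ_{M,N}) = Ψ_N Ψ_{M,M}`, then `β(M + αN) ≤ β(M)` for every `α ∈ ℂ`.
(Printed with the standing assumptions `β(M) ≥ β(N)`, `Ψ_M Ψ_{N,N} ≠ 0`; the direct
Cauchy–Schwarz proof below needs only `Ψ_{M,M} ≠ 0`.) [cite: CechMatomaki2025, Corollary 2.6 (ii)] -/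
theorem beta_add_smul_le (hw : ∀ π, 0 ≤ w π) {M N : ι → ℂ} (hMM : msq w L M ≠ 0)
    (hcrit : Psi w L M * conj (Psi2 w L M N) = Psi w L N * (msq w L M : ℂ)) (α : ℂ) :
    beta w L (M + α • N) ≤ beta w L M := by
  have hMpos : 0 < msq w L M := lt_of_le_of_ne (msq_nonneg hw M) (Ne.symm hMM)
  set m : ℝ := msq w L M with hm
  set n : ℝ := msq w L N with hn
  set p : ℂ := Psi w L M with hp
  set c : ℂ := Psi2 w L M N with hc
  have hCS : ‖c‖ ^ 2 ≤ m * n := norm_Psi2_sq_le hw M N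
  -- Ψ_N = p conj(c) / m
  have hN : Psi w L N = p * conj c / (m : ℂ) := by
    rw [eq_div_iff (by exact_mod_cast hMM), ← hcrit]
  have hnum : Psi w L (M + α • N) = p * (1 + α * conj c / (m : ℂ)) := by
    rw [Psi_add_smul, hN]; ring
  have hden : msq w L (M + α • N) = m + 2 * (conj α * c).re + ‖α‖ ^ 2 * n := msq_add_smul M N α
  -- the denominator dominates `m · |1 + α conj c / m|²`
  have hx : m * ‖1 + α * conj c / (m : ℂ)‖ ^ 2 = m + 2 * (conj α * c).re + ‖α * conj c‖ ^ 2 / m := by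
    have hm0 : (m : ℂ) ≠ 0 := by exact_mod_cast hMpos.ne'
    have e1 : 1 + α * conj c / (m : ℂ) = ((m : ℂ) + α * conj c) / (m : ℂ) := by
      field_simp
    have e2 : ‖(m : ℂ) + α * conj c‖ ^ 2 = m ^ 2 + 2 * m * (α * conj c).re + ‖α * conj c‖ ^ 2 := by
      rw [Complex.sq_norm, Complex.sq_norm, Complex.normSq_apply, Complex.normSq_apply]
      simp only [Complex.add_re, Complex.add_im, Complex.ofReal_re, Complex.ofReal_im]
      ring
    have e3 : (α * conj c).re = (conj α * c).re := by
      have : α * conj c = conj (conj α * c) := by rw [map_mul, Complex.conj_conj]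
      rw [this, Complex.conj_re]
    rw [e1, norm_div, Complex.norm_real, Real.norm_of_nonneg hMpos.le, div_pow, e2, e3]
    field_simp
  have hdom : m * ‖1 + α * conj c / (m : ℂ)‖ ^ 2 ≤ msq w L (M + α • N) := by
    rw [hx, hden, norm_mul, Complex.norm_conj, mul_pow]
    have : ‖α‖ ^ 2 * ‖c‖ ^ 2 / m ≤ ‖α‖ ^ 2 * n := by
      rw [div_le_iff₀ hMpos]
      nlinarith [hCS, sq_nonneg ‖α‖]
    linarith
  -- conclude
  unfold beta
  rw [hnum, norm_mul, mul_pow, ← hp, ← hm]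
  by_cases hz : ‖1 + α * conj c / (m : ℂ)‖ = 0
  · rw [hz]; simp only [ne_eq, OfNat.ofNat_ne_zero, not_false_eq_true, zero_pow, mul_zero, zero_div]
    exact div_nonneg (sq_nonneg _) hMpos.le
  have hzpos : 0 < ‖1 + α * conj c / (m : ℂ)‖ ^ 2 := by positivity
  have hDpos : 0 < msq w L (M + α • N) := lt_of_lt_of_le (mul_pos hMpos hzpos) hdom
  rw [div_le_div_iff₀ hDpos hMpos]
  calc ‖p‖ ^ 2 * ‖1 + α * conj c / (m : ℂ)‖ ^ 2 * m
      = ‖p‖ ^ 2 * (m * ‖1 + α * conj c / (m : ℂ)‖ ^ 2) := by ring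
    _ ≤ ‖p‖ ^ 2 * msq w L (M + α • N) := mul_le_mul_of_nonneg_left hdom (sq_nonneg _)

/-- `‖u + v‖² = ‖u‖² + 2 Re(u conj v) + ‖v‖²` in `ℂ` (Mathlib's `Complex.normSq_add` in norm form).
[folklore] -/
private theorem norm_add_sq_eq (u v : ℂ) :
    ‖u + v‖ ^ 2 = ‖u‖ ^ 2 + 2 * (u * conj v).re + ‖v‖ ^ 2 := by
  rw [Complex.sq_norm, Complex.sq_norm, Complex.sq_norm, Complex.normSq_add]
  ring

/-- **Lemma 3.1.** If `β(M) ≥ β(N)`, `Ψ_M Ψ_{N,N} ≠ 0` and `Ψ_N Ψ_{M,N} = Ψ_M Ψ_{N,N}`, then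
`|Ψ_N|² Ψ_{M,M} = |Ψ_M|² Ψ_{N,N}` (both inequalities: from `β(M) ≥ β(N)` and from Cauchy–Schwarz)
and hence `Ψ_N Ψ_{M,M} = Ψ_M conj(Ψ_{M,N})`. [cite: CechMatomaki2025, Lemma 3.1] -/
theorem lemma31 (hw : ∀ π, 0 ≤ w π) {M N : ι → ℂ} (hβ : beta w L N ≤ beta w L M)
    (hne : Psi w L M * (msq w L N : ℂ) ≠ 0)
    (heq : Psi w L N * Psi2 w L M N = Psi w L M * (msq w L N : ℂ)) :
    ‖Psi w L N‖ ^ 2 * msq w L M = ‖Psi w L M‖ ^ 2 * msq w L N ∧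
      Psi w L N * (msq w L M : ℂ) = Psi w L M * conj (Psi2 w L M N) := by
  set m : ℝ := msq w L M with hm
  set n : ℝ := msq w L N with hn
  set a : ℂ := Psi w L M with ha
  set b : ℂ := Psi w L N with hb
  set c : ℂ := Psi2 w L M N with hc
  have ha0 : a ≠ 0 := left_ne_zero_of_mul hne
  have hn0 : n ≠ 0 := by
    have : (n : ℂ) ≠ 0 := right_ne_zero_of_mul hne
    exact_mod_cast this
  have hnpos : 0 < n := lt_of_le_of_ne (msq_nonneg hw N) (Ne.symm hn0)
  have hb0 : b ≠ 0 := by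
    intro h0; apply hne; rw [← heq, h0, zero_mul]
  have hmpos : 0 < m := by
    rcases (msq_nonneg hw M).lt_or_eq with h | h
    · exact h
    · exfalso
      have h1 : beta w L M = 0 := by
        have hm0 : m = 0 := by rw [hm]; exact h.symm
        change ‖a‖ ^ 2 / m = 0
        rw [hm0, div_zero]
      have h2 : 0 < beta w L N := by
        change 0 < ‖b‖ ^ 2 / n
        exact div_pos (pow_pos (norm_pos_iff.mpr hb0) 2) hnpos
      linarith
  have hle : ‖b‖ ^ 2 * m ≤ ‖a‖ ^ 2 * n := by
    have h := hβ
    change ‖b‖ ^ 2 / n ≤ ‖a‖ ^ 2 / m at h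
    rwa [div_le_div_iff₀ hnpos hmpos] at h
  have hge : ‖a‖ ^ 2 * n ≤ ‖b‖ ^ 2 * m := by
    have hCS : ‖c‖ ^ 2 ≤ m * n := norm_Psi2_sq_le hw M N
    have h1 : ‖b‖ ^ 2 * ‖c‖ ^ 2 = ‖a‖ ^ 2 * n ^ 2 := by
      have := congrArg (fun z : ℂ => ‖z‖ ^ 2) heq
      simpa only [norm_mul, mul_pow, Complex.norm_real, Real.norm_of_nonneg hnpos.le] using this
    nlinarith [hCS, sq_nonneg ‖b‖, hnpos]
  have hE : ‖b‖ ^ 2 * m = ‖a‖ ^ 2 * n := le_antisymm hle hge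
  refine ⟨hE, ?_⟩
  have hcb : conj b ≠ 0 := (map_ne_zero _).mpr hb0
  have hc' : c = a * (n : ℂ) / b := by
    rw [eq_div_iff hb0, mul_comm c b]; exact heq
  have hE' : b * conj b * (m : ℂ) = a * conj a * (n : ℂ) := by
    rw [Complex.mul_conj, Complex.mul_conj, Complex.normSq_eq_norm_sq, Complex.normSq_eq_norm_sq]
    exact_mod_cast hE
  rw [hc', map_div₀, map_mul, Complex.conj_ofReal, mul_div_assoc', eq_div_iff hcb]
  linear_combination hE'

/-- **Theorem 2.5 (i)** (PROVED): under the standing assumptions `β(M) ≥ β(N)`, `Ψ_M Ψ_{N,N} ≠ 0`,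
if `Ψ_N Ψ_{M,N} = Ψ_M Ψ_{N,N}` then `β(M + αN) = β(M)` for every `α ∈ ℂ ∖ {−Ψ_M/Ψ_N}`
("so `N` is useless"). [cite: CechMatomaki2025, Theorem 2.5 (i)] -/
theorem theorem25i (hw : ∀ π, 0 ≤ w π) {M N : ι → ℂ} (hβ : beta w L N ≤ beta w L M)
    (hne : Psi w L M * (msq w L N : ℂ) ≠ 0)
    (heq : Psi w L N * Psi2 w L M N = Psi w L M * (msq w L N : ℂ)) {α : ℂ}
    (hα : α ≠ -(Psi w L M / Psi w L N)) :
    beta w L (M + α • N) = beta w L M := by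
  obtain ⟨hE, hcrit⟩ := lemma31 hw hβ hne heq
  set m : ℝ := msq w L M with hm
  set n : ℝ := msq w L N with hn
  set a : ℂ := Psi w L M with ha
  set b : ℂ := Psi w L N with hb
  set c : ℂ := Psi2 w L M N with hc
  have ha0 : a ≠ 0 := left_ne_zero_of_mul hne
  have hb0 : b ≠ 0 := by
    intro h0; apply hne; rw [← heq, h0, zero_mul]
  have hn0 : n ≠ 0 := by
    have : (n : ℂ) ≠ 0 := right_ne_zero_of_mul hne
    exact_mod_cast this
  have hnpos : 0 < n := lt_of_le_of_ne (msq_nonneg hw N) (Ne.symm hn0)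
  have hA : 0 < ‖a‖ ^ 2 := by positivity
  have hB : 0 < ‖b‖ ^ 2 := by positivity
  have hmpos : 0 < m := by
    have h : m = ‖a‖ ^ 2 * n / ‖b‖ ^ 2 := by
      rw [eq_div_iff hB.ne', mul_comm]; exact hE
    rw [h]; positivity
  have hnum : Psi w L (M + α • N) = a + α * b := Psi_add_smul M N α
  have hden : msq w L (M + α • N) = m + 2 * (conj α * c).re + ‖α‖ ^ 2 * n :=
    msq_add_smul M N α
  have hca : conj a ≠ 0 := (map_ne_zero _).mpr ha0
  have hc' : c = conj b * (m : ℂ) / conj a := by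
    have h := congrArg conj hcrit
    simp only [map_mul, Complex.conj_ofReal, Complex.conj_conj] at h
    rw [eq_div_iff hca]
    linear_combination -h
  have hn' : n = ‖b‖ ^ 2 * m / ‖a‖ ^ 2 := by
    rw [eq_div_iff hA.ne', mul_comm]; exact hE.symm
  have hsq : ((‖a‖ ^ 2 : ℝ) : ℂ) = a * conj a := by
    rw [Complex.ofReal_pow, ← Complex.mul_conj']
  have h1 : conj α * c = (m : ℂ) * (a * conj (α * b)) / ((‖a‖ ^ 2 : ℝ) : ℂ) := by
    rw [hc', hsq, map_mul]
    field_simp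
  have h2 : (conj α * c).re = m * (a * conj (α * b)).re / ‖a‖ ^ 2 := by
    rw [h1, Complex.div_ofReal_re, Complex.re_ofReal_mul]
  have key : msq w L (M + α • N) * ‖a‖ ^ 2 = m * ‖a + α * b‖ ^ 2 := by
    rw [hden, h2, hn', norm_add_sq_eq, norm_mul, mul_pow]
    field_simp
  have hS : 0 < ‖a + α * b‖ ^ 2 := by
    have h0 : a + α * b ≠ 0 := by
      intro h0
      apply hα
      rw [← neg_div, eq_div_iff hb0]
      linear_combination h0
    positivity
  have hDpos : 0 < msq w L (M + α • N) := by
    have h : 0 < msq w L (M + α • N) * ‖a‖ ^ 2 := by rw [key]; positivity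
    exact (mul_pos_iff_of_pos_right hA).mp h
  unfold beta
  rw [hnum, div_eq_div_iff hDpos.ne' hmpos.ne']
  linear_combination (-1 : ℝ) * key

/-- The weighted proportion of non-vanishing is at most `1`. [cite: CechMatomaki2025, §2 (2.1)] -/
theorem nonvanishingProportion_le_one (hw : ∀ π, 0 ≤ w π) : nonvanishingProportion w L ≤ 1 := by
  classical
  unfold nonvanishingProportion
  by_cases hW : totalWeight w = 0
  · rw [hW, div_zero]; exact zero_le_one
  have hWpos : 0 < totalWeight w := lt_of_le_of_ne (totalWeight_nonneg hw) (Ne.symm hW)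
  rw [div_le_one hWpos]
  exact sum_le_sum fun π _ => by split_ifs <;> [exact hw π; exact le_rfl]

/-- `β(M) ≤ 1`: the Cauchy–Schwarz quantity `β` is a PROPORTION (sanity check on the
normalisation of `Ψ` by the total weight). [cite: CechMatomaki2025, §2 (2.1)] -/
theorem beta_le_one (hw : ∀ π, 0 ≤ w π) (M : ι → ℂ) : beta w L M ≤ 1 :=
  (beta_le_nonvanishingProportion hw M).trans (nonvanishingProportion_le_one hw)

/-- **Theorem 2.5 (ii)** PROVED (universe-polymorphic form; the named fact
`cechMatomaki2025_theorem25ii`, which quantifies `ι : Type`, is discharged from it below).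
Route (a Gram-matrix form of the printed case analysis): with `a = Ψ_M`, `b = Ψ_N`, `c = Ψ_{M,N}`,
`m = Ψ_{M,M}`, `n = Ψ_{N,N}`, `D = mn − |c|²`, `P = conj(a)c − conj(b)m`, `Q = conj(a)n − conj(b)conj(c)`,
`K = |b|²m + |a|²n − 2Re(conj(a)bc)`: (1) `m > 0` by (2.1) and `D > 0` by Cauchy–Schwarz applied to
`M − (c/n)N` (Lemma 3.3 (i)); (2) the Lagrange identity `K·Ψ_{M+αN,M+αN} − D·|Ψ_{M+αN}|² = |P + αQ|²`
for every `α`, and `n·Ψ_{M+αN,M+αN} = |c + nα|² + D > 0` (Lemma 3.3 (ii)); (3) hence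
`β(M+αN) ≤ K/D` with equality at `α₁ = −P/Q`, and `K/D = β(M) + |P|²/(mD)` (the identity at `α = 0`).
The standing assumption `β(M) ≥ β(N)` is carried as printed but NOT used by this proof.
[cite: CechMatomaki2025, Theorem 2.5 (ii)] -/
theorem theorem25ii (hw : ∀ π, 0 ≤ w π) {M N : ι → ℂ} (_hβ : beta w L N ≤ beta w L M)
    (hne : Psi w L M * (msq w L N : ℂ) ≠ 0)
    (hneq : Psi w L N * Psi2 w L M N ≠ Psi w L M * (msq w L N : ℂ)) :
    let α₁ : ℂ := (conj (Psi w L M) * Psi2 w L M N - conj (Psi w L N) * (msq w L M : ℂ)) /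
      (conj (Psi w L N) * conj (Psi2 w L M N) - conj (Psi w L M) * (msq w L N : ℂ))
    0 < msq w L M * (msq w L M * msq w L N - ‖Psi2 w L M N‖ ^ 2) ∧
    beta w L (M + α₁ • N) = beta w L M +
      ‖conj (Psi w L M) * Psi2 w L M N - conj (Psi w L N) * (msq w L M : ℂ)‖ ^ 2 /
        (msq w L M * (msq w L M * msq w L N - ‖Psi2 w L M N‖ ^ 2)) ∧
    ∀ α : ℂ, beta w L (M + α • N) ≤ beta w L (M + α₁ • N) := by
  intro α₁
  set m : ℝ := msq w L M with hm
  set n : ℝ := msq w L N with hn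
  set a : ℂ := Psi w L M with ha
  set b : ℂ := Psi w L N with hb
  set c : ℂ := Psi2 w L M N with hc
  -- basic signs
  have ha0 : a ≠ 0 := left_ne_zero_of_mul hne
  have hn0 : n ≠ 0 := by
    have h : (n : ℂ) ≠ 0 := right_ne_zero_of_mul hne
    exact_mod_cast h
  have hn0' : 0 ≤ n := msq_nonneg hw N
  have hnpos : 0 < n := lt_of_le_of_ne hn0' (Ne.symm hn0)
  have hprop1 : nonvanishingProportion w L ≤ 1 := nonvanishingProportion_le_one hw
  have hCS1 : ∀ F : ι → ℂ, ‖Psi w L F‖ ^ 2 ≤ msq w L F := fun F =>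
    (norm_Psi_sq_le hw F).trans (mul_le_of_le_one_left (msq_nonneg hw F) hprop1)
  have hm0 : 0 ≤ m := msq_nonneg hw M
  have hCSa : ‖a‖ ^ 2 ≤ m := hCS1 M
  have hmpos : 0 < m := by
    rcases hm0.lt_or_eq with h | h
    · exact h
    · exfalso
      have h1 : ‖a‖ ^ 2 ≤ 0 := by
        calc ‖a‖ ^ 2 ≤ m := hCSa
          _ = 0 := h.symm
      have h2 : ‖a‖ = 0 := by nlinarith [norm_nonneg a]
      exact ha0 (norm_eq_zero.mp h2)
  -- D > 0 (Lemma 3.3 (i)) via the test combination `M − (c/n) N`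
  set D : ℝ := m * n - ‖c‖ ^ 2 with hD
  have hq0 : msq w L (M + (-(c / (n : ℂ))) • N) = D / n := by
    rw [msq_add_smul]
    change m + 2 * (conj (-(c / (n : ℂ))) * c).re + ‖-(c / (n : ℂ))‖ ^ 2 * n = D / n
    have e1 : (conj (-(c / (n : ℂ))) * c).re = -(‖c‖ ^ 2 / n) := by
      rw [map_neg, map_div₀, Complex.conj_ofReal, neg_mul, Complex.neg_re, div_mul_eq_mul_div,
        Complex.conj_mul', Complex.div_ofReal_re, ← Complex.ofReal_pow, Complex.ofReal_re]
    have e2 : ‖-(c / (n : ℂ))‖ ^ 2 = ‖c‖ ^ 2 / n ^ 2 := by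
      rw [norm_neg, norm_div, Complex.norm_real, Real.norm_of_nonneg hnpos.le, div_pow]
    rw [e1, e2, hD]
    field_simp
    ring
  have hPsi0 : Psi w L (M + (-(c / (n : ℂ))) • N) = ((n : ℂ) * a - c * b) / (n : ℂ) := by
    rw [Psi_add_smul]
    change a + -(c / (n : ℂ)) * b = ((n : ℂ) * a - c * b) / (n : ℂ)
    have : (n : ℂ) ≠ 0 := by exact_mod_cast hn0
    field_simp
    ring
  have hkey0 : ‖(n : ℂ) * a - c * b‖ ^ 2 ≤ n * D := by
    have h := hCS1 (M + (-(c / (n : ℂ))) • N)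
    rw [hPsi0, hq0, norm_div, Complex.norm_real, Real.norm_of_nonneg hnpos.le, div_pow,
      div_le_div_iff₀ (by positivity) hnpos] at h
    nlinarith [h, hnpos]
  have hz : (n : ℂ) * a - c * b ≠ 0 := by
    intro h0
    apply hneq
    linear_combination (-1 : ℂ) * h0
  have hDpos : 0 < D := by
    have h1 : 0 < ‖(n : ℂ) * a - c * b‖ ^ 2 := by positivity
    exact (mul_pos_iff_of_pos_left hnpos).mp (lt_of_lt_of_le h1 hkey0)
  -- the Lagrange identity
  set P : ℂ := conj a * c - conj b * (m : ℂ) with hP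
  set Q : ℂ := conj a * (n : ℂ) - conj b * conj c with hQ
  set K : ℝ := ‖b‖ ^ 2 * m + ‖a‖ ^ 2 * n - 2 * (conj a * b * c).re with hK
  have hid : ∀ α : ℂ, K * msq w L (M + α • N) - D * ‖a + α * b‖ ^ 2 = ‖P + α * Q‖ ^ 2 := by
    intro α
    apply Complex.ofReal_injective
    have hq : ((msq w L (M + α • N) : ℝ) : ℂ) =
        (m : ℂ) + (conj α * c + α * conj c) + α * conj α * (n : ℂ) := by
      rw [msq_add_smul]
      change (((m + 2 * (conj α * c).re + ‖α‖ ^ 2 * n : ℝ)) : ℂ) = _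
      push_cast
      rw [Complex.re_eq_add_conj, map_mul, Complex.conj_conj, ← Complex.mul_conj']
      ring
    rw [hK, hD]
    push_cast
    rw [hq, Complex.re_eq_add_conj]
    simp only [← Complex.mul_conj', map_add, map_sub, map_mul, Complex.conj_conj,
      Complex.conj_ofReal, hP, hQ]
    ring
  -- positivity of all `Ψ_{M+αN, M+αN}` (Lemma 3.3 (ii)): `n Ψ_{M+αN,M+αN} = |c + nα|² + D`
  have hnq : ∀ α : ℂ, n * msq w L (M + α • N) = ‖c + (n : ℂ) * α‖ ^ 2 + D := by
    intro α
    rw [msq_add_smul, norm_add_sq_eq]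
    change n * (m + 2 * (conj α * c).re + ‖α‖ ^ 2 * n) =
      ‖c‖ ^ 2 + 2 * (c * conj ((n : ℂ) * α)).re + ‖(n : ℂ) * α‖ ^ 2 + D
    have e : (c * conj ((n : ℂ) * α)).re = n * (conj α * c).re := by
      rw [map_mul, Complex.conj_ofReal, show c * ((n : ℂ) * conj α) = (n : ℂ) * (conj α * c) by ring,
        Complex.re_ofReal_mul]
    rw [e, norm_mul, Complex.norm_real, Real.norm_of_nonneg hnpos.le, mul_pow, hD]
    ring
  have hqpos : ∀ α : ℂ, 0 < msq w L (M + α • N) := fun α => by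
    have h := hnq α
    have h2 : 0 < n * msq w L (M + α • N) := by rw [h]; positivity
    exact (mul_pos_iff_of_pos_left hnpos).mp h2
  -- β(M + αN) ≤ K / D for every α, with equality at α₁
  have hbound : ∀ α : ℂ, beta w L (M + α • N) ≤ K / D := by
    intro α
    have h := hid α
    have hs : 0 ≤ ‖P + α * Q‖ ^ 2 := sq_nonneg _
    unfold beta
    rw [Psi_add_smul, div_le_div_iff₀ (hqpos α) hDpos]
    change ‖a + α * b‖ ^ 2 * D ≤ K * msq w L (M + α • N)
    linarith
  have hQ0 : Q ≠ 0 := by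
    intro h0
    apply hz
    have h1 := congrArg conj h0
    simp only [hQ, map_sub, map_mul, Complex.conj_conj, Complex.conj_ofReal, map_zero] at h1
    linear_combination h1
  have hα₁ : α₁ = -(P / Q) := by
    show (conj a * c - conj b * (m : ℂ)) / (conj b * conj c - conj a * (n : ℂ)) = -(P / Q)
    rw [← div_neg, hP, hQ, neg_sub]
  have hPQ : P + α₁ * Q = 0 := by
    rw [hα₁, neg_mul, div_mul_cancel₀ P hQ0, add_neg_cancel]
  have hval : beta w L (M + α₁ • N) = K / D := by
    have h := hid α₁
    rw [hPQ, norm_zero, zero_pow two_ne_zero] at h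
    unfold beta
    rw [Psi_add_smul, div_eq_div_iff (hqpos α₁).ne' hDpos.ne']
    change ‖a + α₁ * b‖ ^ 2 * D = K * msq w L (M + α₁ • N)
    linarith
  -- K/D = β(M) + |P|²/(mD): the identity at α = 0
  have hK0 : K * m - D * ‖a‖ ^ 2 = ‖P‖ ^ 2 := by
    have h := hid 0
    simpa only [zero_smul, add_zero, zero_mul] using h
  refine ⟨mul_pos hmpos hDpos, ?_, hval ▸ hbound⟩
  rw [hval]
  unfold beta
  change K / D = ‖a‖ ^ 2 / m + ‖P‖ ^ 2 / (m * D)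
  rw [div_add_div _ _ hmpos.ne' (mul_pos hmpos hDpos).ne', div_eq_div_iff hDpos.ne' (by positivity)]
  linear_combination (m * D) * hK0


/-- **Corollary 2.6 (i)** (PROVED): under the standing assumptions `β(M) ≥ β(N)`, `Ψ_M Ψ_{N,N} ≠ 0`,
if `Ψ_M conj(Ψ_{M,N}) ≠ Ψ_N Ψ_{M,M}` then (2.4) `Ψ_N Ψ_{M,N} ≠ Ψ_M Ψ_{N,N}` holds (contrapositive
of Lemma 3.1), hence the conclusion of Theorem 2.5 (ii), and in particular `β(M + α₁N) > β(M)` for the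
`α₁` of (2.5). [cite: CechMatomaki2025, Corollary 2.6 (i)] -/
theorem corollary26i (hw : ∀ π, 0 ≤ w π) {M N : ι → ℂ} (hβ : beta w L N ≤ beta w L M)
    (hne : Psi w L M * (msq w L N : ℂ) ≠ 0)
    (hP : Psi w L M * conj (Psi2 w L M N) ≠ Psi w L N * (msq w L M : ℂ)) :
    Psi w L N * Psi2 w L M N ≠ Psi w L M * (msq w L N : ℂ) ∧
    beta w L M < beta w L (M +
      ((conj (Psi w L M) * Psi2 w L M N - conj (Psi w L N) * (msq w L M : ℂ)) /
        (conj (Psi w L N) * conj (Psi2 w L M N) - conj (Psi w L M) * (msq w L N : ℂ))) • N) := by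
  have hcorr : Psi w L N * Psi2 w L M N ≠ Psi w L M * (msq w L N : ℂ) := by
    intro h
    exact hP (lemma31 hw hβ hne h).2.symm
  refine ⟨hcorr, ?_⟩
  obtain ⟨hpos, hval, -⟩ := theorem25ii hw hβ hne hcorr
  rw [hval]
  have hP0 : conj (Psi w L M) * Psi2 w L M N - conj (Psi w L N) * (msq w L M : ℂ) ≠ 0 := by
    intro h0
    apply hP
    have h1 := congrArg conj h0
    simp only [map_sub, map_mul, Complex.conj_conj, Complex.conj_ofReal, map_zero] at h1
    exact sub_eq_zero.mp h1
  exact lt_add_of_pos_right _ (div_pos (pow_pos (norm_pos_iff.mpr hP0) 2) hpos)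

/-- **Corollary 2.7** (PROVED; the converse of the criterion): if a class `𝒞` of mollifiers is closed
under `M + αN` and `M ∈ 𝒞` maximises `β` on `𝒞`, then `Ψ_M conj(Ψ_{M,N}) = Ψ_N Ψ_{M,M}` for every
`N ∈ 𝒞` (from Corollary 2.6 (i); the degenerate cases `Ψ_M = 0` or `Ψ_{N,N} = 0`, excluded by the
standing assumptions of Corollary 2.6, are settled directly by Cauchy–Schwarz).
[cite: CechMatomaki2025, Corollary 2.7] -/
theorem corollary27 (hw : ∀ π, 0 ≤ w π) {C : Set (ι → ℂ)}
    (hC : ∀ M ∈ C, ∀ N ∈ C, ∀ α : ℂ, M + α • N ∈ C) {M : ι → ℂ} (hM : M ∈ C)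
    (hmax : ∀ N ∈ C, beta w L N ≤ beta w L M) :
    ∀ N ∈ C, Psi w L M * conj (Psi2 w L M N) = Psi w L N * (msq w L M : ℂ) := by
  intro N hN
  by_contra hP
  by_cases hne : Psi w L M * (msq w L N : ℂ) ≠ 0
  · obtain ⟨-, hlt⟩ := corollary26i hw (hmax N hN) hne hP
    exact absurd (hmax _ (hC M hM N hN _)) (not_le.mpr hlt)
  · apply hP
    have hCS1 : ∀ F : ι → ℂ, ‖Psi w L F‖ ^ 2 ≤ msq w L F := fun F =>
      (norm_Psi_sq_le hw F).trans
        (mul_le_of_le_one_left (msq_nonneg hw F) (nonvanishingProportion_le_one hw))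
    have hn0 : 0 ≤ msq w L N := msq_nonneg hw N
    -- in both degenerate cases `Ψ_N = 0`
    have hb : Psi w L N = 0 := by
      have hβN : beta w L N ≤ 0 := by
        rcases mul_eq_zero.mp (not_ne_iff.mp hne) with ha | hn
        · calc beta w L N ≤ beta w L M := hmax N hN
            _ = 0 := by rw [beta, ha, norm_zero, zero_pow two_ne_zero, zero_div]
        · have hn' : msq w L N = 0 := by exact_mod_cast hn
          rw [beta, hn', div_zero]
      have h2 : ‖Psi w L N‖ ^ 2 ≤ 0 := by
        rcases hn0.lt_or_eq with hpos | hzero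
        · have := hβN
          rw [beta, div_le_iff₀ hpos, zero_mul] at this
          exact this
        · calc ‖Psi w L N‖ ^ 2 ≤ msq w L N := hCS1 N
            _ = 0 := hzero.symm
      have h3 : ‖Psi w L N‖ = 0 := by nlinarith [norm_nonneg (Psi w L N)]
      exact norm_eq_zero.mp h3
    rcases mul_eq_zero.mp (not_ne_iff.mp hne) with ha | hn
    · rw [ha, hb, zero_mul, zero_mul]
    · have hn' : msq w L N = 0 := by exact_mod_cast hn
      have hc : Psi2 w L M N = 0 := by
        have h : ‖Psi2 w L M N‖ ^ 2 ≤ msq w L M * msq w L N := norm_Psi2_sq_le hw M N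
        rw [hn', mul_zero] at h
        have h3 : ‖Psi2 w L M N‖ = 0 := by nlinarith [norm_nonneg (Psi2 w L M N)]
        exact norm_eq_zero.mp h3
      rw [hb, hc, map_zero, mul_zero, zero_mul]

/-- **Corollary 2.8 (i)** (PROVED; quantitative efficiency of the combination when both pieces are
efficient): `δ ∈ (0, ½)`, `Ψ_M Ψ_{N,N} ≠ 0`, `β(M) ≥ β(N) > 0` and
`|conj(Ψ_M)Ψ_{M,N} − conj(Ψ_N)Ψ_{M,M}| ≥ δ² |Ψ_N| Ψ_{M,M}` ⇒ (2.4) holds (so Theorem 2.5 (ii)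
applies) and `β(M + α₁N) − β(M) ≥ δ⁴ β(N)`. [cite: CechMatomaki2025, Corollary 2.8 (i)] -/
theorem corollary28i (hw : ∀ π, 0 ≤ w π) {δ : ℝ} (hδ : 0 < δ) {M N : ι → ℂ}
    (hne : Psi w L M * (msq w L N : ℂ) ≠ 0) (hβ : beta w L N ≤ beta w L M) (hβN : 0 < beta w L N)
    (hyp : δ ^ 2 * (‖Psi w L N‖ * msq w L M) ≤
      ‖conj (Psi w L M) * Psi2 w L M N - conj (Psi w L N) * (msq w L M : ℂ)‖) :
    Psi w L N * Psi2 w L M N ≠ Psi w L M * (msq w L N : ℂ) ∧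
    δ ^ 4 * beta w L N ≤ beta w L (M +
      ((conj (Psi w L M) * Psi2 w L M N - conj (Psi w L N) * (msq w L M : ℂ)) /
        (conj (Psi w L N) * conj (Psi2 w L M N) - conj (Psi w L M) * (msq w L N : ℂ))) • N)
      - beta w L M := by
  set m : ℝ := msq w L M with hm
  set n : ℝ := msq w L N with hn
  set a : ℂ := Psi w L M with ha
  set b : ℂ := Psi w L N with hb
  set c : ℂ := Psi2 w L M N with hc
  set P : ℂ := conj a * c - conj b * (m : ℂ) with hP
  have hn0 : 0 ≤ n := msq_nonneg hw N
  have hm0 : 0 ≤ m := msq_nonneg hw M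
  -- β(N) > 0 forces Ψ_N ≠ 0 and Ψ_{N,N} > 0; β(M) > 0 forces Ψ_{M,M} > 0
  have hb0 : b ≠ 0 := by
    intro h0
    have : beta w L N = 0 := by
      change ‖b‖ ^ 2 / n = 0
      rw [h0, norm_zero, zero_pow two_ne_zero, zero_div]
    linarith
  have hnpos : 0 < n := by
    rcases hn0.lt_or_eq with h | h
    · exact h
    · exfalso
      have : beta w L N = 0 := by
        change ‖b‖ ^ 2 / n = 0
        rw [← h, div_zero]
      linarith
  have hmpos : 0 < m := by
    rcases hm0.lt_or_eq with h | h
    · exact h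
    · exfalso
      have : beta w L M = 0 := by
        change ‖a‖ ^ 2 / m = 0
        rw [← h, div_zero]
      linarith
  have hPpos : 0 < ‖P‖ := by
    have : 0 < δ ^ 2 * (‖b‖ * m) := by
      have := norm_pos_iff.mpr hb0
      positivity
    exact lt_of_lt_of_le this hyp
  have hP0 : P ≠ 0 := norm_pos_iff.mp hPpos
  have hPc : a * conj c ≠ b * (m : ℂ) := by
    intro h0
    apply hP0
    have h1 := congrArg conj h0
    simp only [map_mul, Complex.conj_conj, Complex.conj_ofReal] at h1
    change conj a * c - conj b * (m : ℂ) = 0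
    rw [h1, sub_self]
  obtain ⟨hcorr, -⟩ := corollary26i hw hβ hne hPc
  refine ⟨hcorr, ?_⟩
  obtain ⟨hpos, hval, -⟩ := theorem25ii hw hβ hne hcorr
  rw [hval, add_sub_cancel_left]
  change δ ^ 4 * (‖b‖ ^ 2 / n) ≤ ‖P‖ ^ 2 / (m * (m * n - ‖c‖ ^ 2))
  -- ‖P‖² ≥ δ⁴ ‖b‖² m² and m (mn − |c|²) ≤ m² n
  have hP2 : δ ^ 4 * (‖b‖ ^ 2 * m ^ 2) ≤ ‖P‖ ^ 2 := by
    have h := pow_le_pow_left₀ (by positivity) hyp 2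
    calc δ ^ 4 * (‖b‖ ^ 2 * m ^ 2) = (δ ^ 2 * (‖b‖ * m)) ^ 2 := by ring
      _ ≤ ‖P‖ ^ 2 := h
  have hD : m * (m * n - ‖c‖ ^ 2) ≤ m ^ 2 * n := by nlinarith [sq_nonneg ‖c‖, hmpos]
  calc δ ^ 4 * (‖b‖ ^ 2 / n) = δ ^ 4 * (‖b‖ ^ 2 * m ^ 2) / (m ^ 2 * n) := by
        field_simp
    _ ≤ ‖P‖ ^ 2 / (m ^ 2 * n) := by gcongr
    _ ≤ ‖P‖ ^ 2 / (m * (m * n - ‖c‖ ^ 2)) := by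
        exact div_le_div_of_nonneg_left (sq_nonneg _) hpos hD

/-- **Lemma 3.3 (i)/(iii)** (PROVED, in one quantitative form): for `Ψ_{N,N} > 0`,
`|Ψ_{N,N} Ψ_M − Ψ_{M,N} Ψ_N|² ≤ Ψ_{N,N} (Ψ_{M,M}Ψ_{N,N} − |Ψ_{M,N}|²)` — Cauchy–Schwarz (2.1) applied to
the combination `M − (Ψ_{M,N}/Ψ_{N,N}) N`. Consequently (i) (2.4) ⇒ `Ψ_{M,M}Ψ_{N,N} − |Ψ_{M,N}|² > 0`,
and (iii) `|Ψ_NΨ_{M,N} − Ψ_MΨ_{N,N}| ≥ δΨ_{N,N}|Ψ_M|` ⇒ `Ψ_{M,M}Ψ_{N,N} − |Ψ_{M,N}|² ≥ δ²|Ψ_M|²Ψ_{N,N}`.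
[cite: CechMatomaki2025, Lemma 3.3] -/
theorem lemma33 (hw : ∀ π, 0 ≤ w π) (M N : ι → ℂ) (hn : 0 < msq w L N) :
    ‖(msq w L N : ℂ) * Psi w L M - Psi2 w L M N * Psi w L N‖ ^ 2 ≤
      msq w L N * (msq w L M * msq w L N - ‖Psi2 w L M N‖ ^ 2) := by
  set m : ℝ := msq w L M with hm
  set n : ℝ := msq w L N with hn'
  set a : ℂ := Psi w L M with ha
  set b : ℂ := Psi w L N with hb
  set c : ℂ := Psi2 w L M N with hc
  have hCS1 : ∀ F : ι → ℂ, ‖Psi w L F‖ ^ 2 ≤ msq w L F := fun F =>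
    (norm_Psi_sq_le hw F).trans
      (mul_le_of_le_one_left (msq_nonneg hw F) (nonvanishingProportion_le_one hw))
  have hn0 : (n : ℂ) ≠ 0 := by exact_mod_cast hn.ne'
  have hq0 : msq w L (M + (-(c / (n : ℂ))) • N) = (m * n - ‖c‖ ^ 2) / n := by
    rw [msq_add_smul]
    change m + 2 * (conj (-(c / (n : ℂ))) * c).re + ‖-(c / (n : ℂ))‖ ^ 2 * n = (m * n - ‖c‖ ^ 2) / n
    have e1 : (conj (-(c / (n : ℂ))) * c).re = -(‖c‖ ^ 2 / n) := by
      rw [map_neg, map_div₀, Complex.conj_ofReal, neg_mul, Complex.neg_re, div_mul_eq_mul_div,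
        Complex.conj_mul', Complex.div_ofReal_re, ← Complex.ofReal_pow, Complex.ofReal_re]
    have e2 : ‖-(c / (n : ℂ))‖ ^ 2 = ‖c‖ ^ 2 / n ^ 2 := by
      rw [norm_neg, norm_div, Complex.norm_real, Real.norm_of_nonneg hn.le, div_pow]
    rw [e1, e2]
    field_simp
    ring
  have hPsi0 : Psi w L (M + (-(c / (n : ℂ))) • N) = ((n : ℂ) * a - c * b) / (n : ℂ) := by
    rw [Psi_add_smul]
    change a + -(c / (n : ℂ)) * b = ((n : ℂ) * a - c * b) / (n : ℂ)
    field_simp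
    ring
  have h := hCS1 (M + (-(c / (n : ℂ))) • N)
  rw [hPsi0, hq0, norm_div, Complex.norm_real, Real.norm_of_nonneg hn.le, div_pow,
    div_le_div_iff₀ (by positivity) hn] at h
  nlinarith [h, hn]

/-- **Corollary 2.8 (ii)** (PROVED): `δ > 0`, `Ψ_MΨ_{N,N} ≠ 0`, `β(M) ≥ β(N) > 0`,
`|conj(Ψ_M)Ψ_{M,N} − conj(Ψ_N)Ψ_{M,M}| < δ²|Ψ_N|Ψ_{M,M}` and `|Ψ_NΨ_{M,N} − Ψ_MΨ_{N,N}| ≥ δΨ_{N,N}|Ψ_M|`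
⇒ (2.4) holds and `β(M + αN) − β(M) ≤ δ² β(N)/β(M) ≤ δ²` for every `α ∈ ℂ`.
[cite: CechMatomaki2025, Corollary 2.8 (ii)] -/
theorem corollary28ii (hw : ∀ π, 0 ≤ w π) {δ : ℝ} (hδ : 0 < δ) {M N : ι → ℂ}
    (hne : Psi w L M * (msq w L N : ℂ) ≠ 0) (hβ : beta w L N ≤ beta w L M) (hβN : 0 < beta w L N)
    (hup : ‖conj (Psi w L M) * Psi2 w L M N - conj (Psi w L N) * (msq w L M : ℂ)‖ <
      δ ^ 2 * (‖Psi w L N‖ * msq w L M))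
    (hlow : δ * (msq w L N * ‖Psi w L M‖) ≤ ‖Psi w L N * Psi2 w L M N - Psi w L M * (msq w L N : ℂ)‖) :
    Psi w L N * Psi2 w L M N ≠ Psi w L M * (msq w L N : ℂ) ∧
    ∀ α : ℂ, beta w L (M + α • N) - beta w L M ≤ δ ^ 2 * (beta w L N / beta w L M) ∧
      δ ^ 2 * (beta w L N / beta w L M) ≤ δ ^ 2 := by
  set m : ℝ := msq w L M with hm
  set n : ℝ := msq w L N with hn
  set a : ℂ := Psi w L M with ha
  set b : ℂ := Psi w L N with hb
  set c : ℂ := Psi2 w L M N with hc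
  set P : ℂ := conj a * c - conj b * (m : ℂ) with hP
  have ha0 : a ≠ 0 := left_ne_zero_of_mul hne
  have hn0 : n ≠ 0 := by
    have h : (n : ℂ) ≠ 0 := right_ne_zero_of_mul hne
    exact_mod_cast h
  have hnpos : 0 < n := lt_of_le_of_ne (msq_nonneg hw N) (Ne.symm hn0)
  have hβM : 0 < beta w L M := lt_of_lt_of_le hβN hβ
  have hm0 : 0 ≤ m := msq_nonneg hw M
  have hmpos : 0 < m := by
    rcases hm0.lt_or_eq with h | h
    · exact h
    · exfalso
      have : beta w L M = 0 := by
        change ‖a‖ ^ 2 / m = 0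
        rw [← h, div_zero]
      linarith
  have hcorr : b * c ≠ a * (n : ℂ) := by
    intro h0
    have h1 : ‖b * c - a * (n : ℂ)‖ = 0 := by rw [h0, sub_self, norm_zero]
    have h2 : 0 < δ * (n * ‖a‖) := by
      have := norm_pos_iff.mpr ha0
      positivity
    have h3 := hlow
    change δ * (n * ‖a‖) ≤ ‖b * c - a * (n : ℂ)‖ at h3
    linarith
  refine ⟨hcorr, fun α => ?_⟩
  obtain ⟨hpos, hval, hmax⟩ := theorem25ii hw hβ hne hcorr
  set α₁ : ℂ := (conj a * c - conj b * (m : ℂ)) / (conj b * conj c - conj a * (n : ℂ)) with hα₁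
  have hD : δ ^ 2 * (n * ‖a‖ ^ 2) ≤ m * n - ‖c‖ ^ 2 := by
    have h33 : ‖(n : ℂ) * a - c * b‖ ^ 2 ≤ n * (m * n - ‖c‖ ^ 2) := lemma33 hw M N hnpos
    have e : ‖(n : ℂ) * a - c * b‖ = ‖b * c - a * (n : ℂ)‖ := by
      rw [← norm_neg]; congr 1; ring
    have h3 := hlow
    change δ * (n * ‖a‖) ≤ ‖b * c - a * (n : ℂ)‖ at h3
    have h4 : (δ * (n * ‖a‖)) ^ 2 ≤ ‖b * c - a * (n : ℂ)‖ ^ 2 :=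
      pow_le_pow_left₀ (by positivity) h3 2
    rw [← e] at h4
    nlinarith [h33, h4, hnpos]
  have hratio : beta w L N / beta w L M = ‖b‖ ^ 2 * m / (n * ‖a‖ ^ 2) := by
    change (‖b‖ ^ 2 / n) / (‖a‖ ^ 2 / m) = ‖b‖ ^ 2 * m / (n * ‖a‖ ^ 2)
    have : ‖a‖ ^ 2 ≠ 0 := by positivity
    field_simp
  constructor
  · calc beta w L (M + α • N) - beta w L M
        ≤ beta w L (M + α₁ • N) - beta w L M := by linarith [hmax α]
      _ = ‖P‖ ^ 2 / (m * (m * n - ‖c‖ ^ 2)) := by rw [hval, add_sub_cancel_left]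
      _ ≤ (δ ^ 2 * (‖b‖ * m)) ^ 2 / (m * (δ ^ 2 * (n * ‖a‖ ^ 2))) := by
          have hup' : ‖P‖ < δ ^ 2 * (‖b‖ * m) := hup
          have h1 : ‖P‖ ^ 2 ≤ (δ ^ 2 * (‖b‖ * m)) ^ 2 :=
            pow_le_pow_left₀ (norm_nonneg _) hup'.le 2
          have h2 : 0 < m * (δ ^ 2 * (n * ‖a‖ ^ 2)) := by
            have := norm_pos_iff.mpr ha0
            positivity
          calc ‖P‖ ^ 2 / (m * (m * n - ‖c‖ ^ 2)) ≤ ‖P‖ ^ 2 / (m * (δ ^ 2 * (n * ‖a‖ ^ 2))) :=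
                div_le_div_of_nonneg_left (sq_nonneg _) h2 (by nlinarith [hD, hmpos])
            _ ≤ (δ ^ 2 * (‖b‖ * m)) ^ 2 / (m * (δ ^ 2 * (n * ‖a‖ ^ 2))) := by gcongr
      _ = δ ^ 2 * (beta w L N / beta w L M) := by
          rw [hratio]
          have : ‖a‖ ^ 2 ≠ 0 := by positivity
          field_simp
  · have h1 : beta w L N / beta w L M ≤ 1 := (div_le_one hβM).mpr hβ
    have h2 : 0 ≤ δ ^ 2 := sq_nonneg δ
    nlinarith

/-- **Corollary 2.10, first half** (PROVED; an inefficient second piece): `δ ∈ (0, ½)`,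
`Ψ_MΨ_{N,N} ≠ 0`, `β(N) ≤ (δ/4)β(M)` ⇒ (2.4) holds (so Theorem 2.5 (ii) applies), and
(i) `|Ψ_{M,N}|² ≥ δΨ_{M,M}Ψ_{N,N}` ⇒ `β(M+α₁N) − β(M) ≥ (δ/4)β(M)`. Part (ii) is `corollary210ii`.
[cite: CechMatomaki2025, Corollary 2.10 (i)] -/
theorem corollary210 (hw : ∀ π, 0 ≤ w π) {δ : ℝ} (hδ : 0 < δ) (hδ' : δ < 1 / 2) {M N : ι → ℂ}
    (hne : Psi w L M * (msq w L N : ℂ) ≠ 0) (hβ : beta w L N ≤ δ / 4 * beta w L M) :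
    Psi w L N * Psi2 w L M N ≠ Psi w L M * (msq w L N : ℂ) ∧
    (δ * (msq w L M * msq w L N) ≤ ‖Psi2 w L M N‖ ^ 2 →
      δ / 4 * beta w L M ≤ beta w L (M +
        ((conj (Psi w L M) * Psi2 w L M N - conj (Psi w L N) * (msq w L M : ℂ)) /
          (conj (Psi w L N) * conj (Psi2 w L M N) - conj (Psi w L M) * (msq w L N : ℂ))) • N)
        - beta w L M) := by
  set m : ℝ := msq w L M with hm
  set n : ℝ := msq w L N with hn
  set a : ℂ := Psi w L M with ha
  set b : ℂ := Psi w L N with hb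
  set c : ℂ := Psi2 w L M N with hc
  set P : ℂ := conj a * c - conj b * (m : ℂ) with hP
  have ha0 : a ≠ 0 := left_ne_zero_of_mul hne
  have hA : 0 < ‖a‖ := norm_pos_iff.mpr ha0
  have hn0 : n ≠ 0 := by
    have h : (n : ℂ) ≠ 0 := right_ne_zero_of_mul hne
    exact_mod_cast h
  have hnpos : 0 < n := lt_of_le_of_ne (msq_nonneg hw N) (Ne.symm hn0)
  have hm0 : 0 ≤ m := msq_nonneg hw M
  have hCSa : ‖a‖ ^ 2 ≤ m :=
    (norm_Psi_sq_le hw M).trans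
      (mul_le_of_le_one_left (msq_nonneg hw M) (nonvanishingProportion_le_one hw))
  have hmpos : 0 < m := by
    rcases hm0.lt_or_eq with h | h
    · exact h
    · exfalso
      have h1 : ‖a‖ ^ 2 ≤ 0 := by
        calc ‖a‖ ^ 2 ≤ m := hCSa
          _ = 0 := h.symm
      have h2 : 0 < ‖a‖ ^ 2 := by positivity
      linarith
  have hCS : ‖c‖ ^ 2 ≤ m * n := norm_Psi2_sq_le hw M N
  have hβM : beta w L M = ‖a‖ ^ 2 / m := rfl
  -- `|Ψ_N|² Ψ_{M,M} ≤ (δ/4) |Ψ_M|² Ψ_{N,N}`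
  have hbm : ‖b‖ ^ 2 * m ≤ δ / 4 * (‖a‖ ^ 2 * n) := by
    have h : ‖b‖ ^ 2 / n ≤ δ / 4 * (‖a‖ ^ 2 / m) := hβ
    calc ‖b‖ ^ 2 * m = (‖b‖ ^ 2 / n) * n * m := by field_simp
      _ ≤ (δ / 4 * (‖a‖ ^ 2 / m)) * n * m := by gcongr
      _ = δ / 4 * (‖a‖ ^ 2 * n) := by field_simp
  have hβ' : beta w L N ≤ beta w L M := by
    calc beta w L N ≤ δ / 4 * beta w L M := hβ
      _ ≤ 1 * beta w L M := by
          gcongr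
          · exact div_nonneg (sq_nonneg _) hm0
          · linarith
      _ = beta w L M := one_mul _
  -- (2.4)
  have hcorr : b * c ≠ a * (n : ℂ) := by
    intro h0
    have h1 : ‖b‖ ^ 2 * ‖c‖ ^ 2 = ‖a‖ ^ 2 * n ^ 2 := by
      have := congrArg (fun z : ℂ => ‖z‖ ^ 2) h0
      simpa only [norm_mul, mul_pow, Complex.norm_real, Real.norm_of_nonneg hnpos.le] using this
    have h2 : ‖a‖ ^ 2 * n ^ 2 ≤ δ / 4 * (‖a‖ ^ 2 * n ^ 2) := by
      calc ‖a‖ ^ 2 * n ^ 2 = ‖b‖ ^ 2 * ‖c‖ ^ 2 := h1.symm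
        _ ≤ ‖b‖ ^ 2 * (m * n) := by gcongr
        _ = ‖b‖ ^ 2 * m * n := by ring
        _ ≤ δ / 4 * (‖a‖ ^ 2 * n) * n := by gcongr
        _ = δ / 4 * (‖a‖ ^ 2 * n ^ 2) := by ring
    have h3 : 0 < ‖a‖ ^ 2 * n ^ 2 := by positivity
    have h4 : δ / 4 * (‖a‖ ^ 2 * n ^ 2) < ‖a‖ ^ 2 * n ^ 2 :=
      mul_lt_of_lt_one_left h3 (by linarith)
    linarith
  obtain ⟨hpos, hval, hmax⟩ := theorem25ii hw hβ' hne hcorr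
  refine ⟨hcorr, fun hcl => ?_⟩
  -- ‖P‖ ≥ ‖a‖‖c‖ − ‖b‖ m ≥ ‖a‖‖c‖/2
  rw [hval, add_sub_cancel_left, hβM]
  have hcl' : δ * (m * n) ≤ ‖c‖ ^ 2 := hcl
  have hbm2 : ‖b‖ * m ≤ ‖a‖ * ‖c‖ / 2 := by
    have h1 : (‖b‖ * m) ^ 2 ≤ (‖a‖ * ‖c‖ / 2) ^ 2 := by
      calc (‖b‖ * m) ^ 2 = (‖b‖ ^ 2 * m) * m := by ring
        _ ≤ (δ / 4 * (‖a‖ ^ 2 * n)) * m := by gcongr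
        _ = ‖a‖ ^ 2 / 4 * (δ * (m * n)) := by ring
        _ ≤ ‖a‖ ^ 2 / 4 * ‖c‖ ^ 2 := by gcongr
        _ = (‖a‖ * ‖c‖ / 2) ^ 2 := by ring
    exact (pow_le_pow_iff_left₀ (by positivity) (by positivity) two_ne_zero).mp h1
  have hPge : ‖a‖ * ‖c‖ / 2 ≤ ‖P‖ := by
    have h1 : ‖conj a * c‖ - ‖conj b * (m : ℂ)‖ ≤ ‖P‖ := norm_sub_norm_le _ _
    rw [norm_mul, norm_mul, Complex.norm_conj, Complex.norm_conj, Complex.norm_real,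
      Real.norm_of_nonneg hm0] at h1
    linarith
  have hP2 : δ / 4 * (‖a‖ ^ 2 * (m * n)) ≤ ‖P‖ ^ 2 := by
    have h1 : (‖a‖ * ‖c‖ / 2) ^ 2 ≤ ‖P‖ ^ 2 := pow_le_pow_left₀ (by positivity) hPge 2
    have h2 : ‖a‖ ^ 2 * (δ * (m * n)) ≤ ‖a‖ ^ 2 * ‖c‖ ^ 2 :=
      mul_le_mul_of_nonneg_left hcl' (sq_nonneg _)
    linarith
  have hD : m * (m * n - ‖c‖ ^ 2) ≤ m * (m * n) :=
    mul_le_mul_of_nonneg_left (by linarith [sq_nonneg ‖c‖]) hm0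
  calc δ / 4 * (‖a‖ ^ 2 / m) = δ / 4 * (‖a‖ ^ 2 * (m * n)) / (m * (m * n)) := by
        field_simp
    _ ≤ ‖P‖ ^ 2 / (m * (m * n)) := by gcongr
    _ ≤ ‖P‖ ^ 2 / (m * (m * n - ‖c‖ ^ 2)) :=
        div_le_div_of_nonneg_left (sq_nonneg _) hpos hD

/-- **Corollary 2.10, second half** (PROVED): `δ ∈ (0, ½)`, `Ψ_MΨ_{N,N} ≠ 0`, `β(N) ≤ (δ/4)β(M)` and
(ii) `|Ψ_{M,N}|² ≤ δΨ_{M,M}Ψ_{N,N}` ⇒ `β(M+αN) − β(M) ≤ 5δβ(M)` for every `α ∈ ℂ`.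
[cite: CechMatomaki2025, Corollary 2.10 (ii)] -/
theorem corollary210ii (hw : ∀ π, 0 ≤ w π) {δ : ℝ} (hδ : 0 < δ) (hδ' : δ < 1 / 2) {M N : ι → ℂ}
    (hne : Psi w L M * (msq w L N : ℂ) ≠ 0) (hβ : beta w L N ≤ δ / 4 * beta w L M)
    (hcu : ‖Psi2 w L M N‖ ^ 2 ≤ δ * (msq w L M * msq w L N)) (α : ℂ) :
    beta w L (M + α • N) - beta w L M ≤ 5 * δ * beta w L M := by
  set m : ℝ := msq w L M with hm
  set n : ℝ := msq w L N with hn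
  set a : ℂ := Psi w L M with ha
  set b : ℂ := Psi w L N with hb
  set c : ℂ := Psi2 w L M N with hc
  set P : ℂ := conj a * c - conj b * (m : ℂ) with hP
  have ha0 : a ≠ 0 := left_ne_zero_of_mul hne
  have hA : 0 < ‖a‖ := norm_pos_iff.mpr ha0
  have hn0 : n ≠ 0 := by
    have h : (n : ℂ) ≠ 0 := right_ne_zero_of_mul hne
    exact_mod_cast h
  have hnpos : 0 < n := lt_of_le_of_ne (msq_nonneg hw N) (Ne.symm hn0)
  have hm0 : 0 ≤ m := msq_nonneg hw M
  have hCSa : ‖a‖ ^ 2 ≤ m :=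
    (norm_Psi_sq_le hw M).trans
      (mul_le_of_le_one_left (msq_nonneg hw M) (nonvanishingProportion_le_one hw))
  have hmpos : 0 < m := by
    rcases hm0.lt_or_eq with h | h
    · exact h
    · exfalso
      have h1 : ‖a‖ ^ 2 ≤ 0 := by
        calc ‖a‖ ^ 2 ≤ m := hCSa
          _ = 0 := h.symm
      have h2 : 0 < ‖a‖ ^ 2 := by positivity
      linarith
  have hCS : ‖c‖ ^ 2 ≤ m * n := norm_Psi2_sq_le hw M N
  have hβM : beta w L M = ‖a‖ ^ 2 / m := rfl
  -- `|Ψ_N|² Ψ_{M,M} ≤ (δ/4) |Ψ_M|² Ψ_{N,N}`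
  have hbm : ‖b‖ ^ 2 * m ≤ δ / 4 * (‖a‖ ^ 2 * n) := by
    have h : ‖b‖ ^ 2 / n ≤ δ / 4 * (‖a‖ ^ 2 / m) := hβ
    calc ‖b‖ ^ 2 * m = (‖b‖ ^ 2 / n) * n * m := by field_simp
      _ ≤ (δ / 4 * (‖a‖ ^ 2 / m)) * n * m := by gcongr
      _ = δ / 4 * (‖a‖ ^ 2 * n) := by field_simp
  have hβ' : beta w L N ≤ beta w L M := by
    calc beta w L N ≤ δ / 4 * beta w L M := hβ
      _ ≤ 1 * beta w L M := by
          gcongr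
          · exact div_nonneg (sq_nonneg _) hm0
          · linarith
      _ = beta w L M := one_mul _
  -- (2.4)
  have hcorr : b * c ≠ a * (n : ℂ) := by
    intro h0
    have h1 : ‖b‖ ^ 2 * ‖c‖ ^ 2 = ‖a‖ ^ 2 * n ^ 2 := by
      have := congrArg (fun z : ℂ => ‖z‖ ^ 2) h0
      simpa only [norm_mul, mul_pow, Complex.norm_real, Real.norm_of_nonneg hnpos.le] using this
    have h2 : ‖a‖ ^ 2 * n ^ 2 ≤ δ / 4 * (‖a‖ ^ 2 * n ^ 2) := by
      calc ‖a‖ ^ 2 * n ^ 2 = ‖b‖ ^ 2 * ‖c‖ ^ 2 := h1.symm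
        _ ≤ ‖b‖ ^ 2 * (m * n) := by gcongr
        _ = ‖b‖ ^ 2 * m * n := by ring
        _ ≤ δ / 4 * (‖a‖ ^ 2 * n) * n := by gcongr
        _ = δ / 4 * (‖a‖ ^ 2 * n ^ 2) := by ring
    have h3 : 0 < ‖a‖ ^ 2 * n ^ 2 := by positivity
    have h4 : δ / 4 * (‖a‖ ^ 2 * n ^ 2) < ‖a‖ ^ 2 * n ^ 2 :=
      mul_lt_of_lt_one_left h3 (by linarith)
    linarith
  obtain ⟨hpos, hval, hmax⟩ := theorem25ii hw hβ' hne hcorr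
  have hcu' : ‖c‖ ^ 2 ≤ δ * (m * n) := hcu
  have h1 : beta w L (M + α • N) ≤ beta w L M + ‖P‖ ^ 2 / (m * (m * n - ‖c‖ ^ 2)) := by
    have h := hmax α
    rw [hval] at h
    exact h
  have h2 : ‖P‖ ^ 2 / (m * (m * n - ‖c‖ ^ 2)) ≤ 5 * δ * (‖a‖ ^ 2 / m) := by
    rw [div_le_iff₀ hpos]
    have hP2 : ‖P‖ ^ 2 ≤ 2 * (‖a‖ ^ 2 * ‖c‖ ^ 2) + 2 * (‖b‖ ^ 2 * m ^ 2) := by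
      have h1 : ‖P‖ ≤ ‖conj a * c‖ + ‖conj b * (m : ℂ)‖ := norm_sub_le _ _
      rw [norm_mul, norm_mul, Complex.norm_conj, Complex.norm_conj, Complex.norm_real,
        Real.norm_of_nonneg hm0] at h1
      have h2 : ‖P‖ ^ 2 ≤ (‖a‖ * ‖c‖ + ‖b‖ * m) ^ 2 :=
        pow_le_pow_left₀ (norm_nonneg _) h1 2
      have h3 : 0 ≤ (‖a‖ * ‖c‖ - ‖b‖ * m) ^ 2 := sq_nonneg _
      nlinarith [h2, h3]
    have hDlow : m * n / 2 ≤ m * n - ‖c‖ ^ 2 := by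
      have : δ * (m * n) ≤ 1 / 2 * (m * n) := mul_le_mul_of_nonneg_right hδ'.le (by positivity)
      linarith
    have h3 : ‖P‖ ^ 2 ≤ 5 / 2 * δ * (‖a‖ ^ 2 * (m * n)) := by
      have e1 : ‖a‖ ^ 2 * ‖c‖ ^ 2 ≤ ‖a‖ ^ 2 * (δ * (m * n)) :=
        mul_le_mul_of_nonneg_left hcu' (sq_nonneg _)
      have e2 : ‖b‖ ^ 2 * m ^ 2 ≤ δ / 4 * (‖a‖ ^ 2 * n) * m := by
        calc ‖b‖ ^ 2 * m ^ 2 = ‖b‖ ^ 2 * m * m := by ring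
          _ ≤ δ / 4 * (‖a‖ ^ 2 * n) * m := by gcongr
      linarith
    have e : 5 * δ * (‖a‖ ^ 2 / m) * (m * (m * n - ‖c‖ ^ 2)) =
        5 * δ * ‖a‖ ^ 2 * (m * n - ‖c‖ ^ 2) := by
      field_simp
    rw [e]
    have h5 : 0 ≤ 5 * δ * ‖a‖ ^ 2 := by positivity
    have h6 := mul_le_mul_of_nonneg_left hDlow h5
    linarith
  rw [hβM]
  linarith [h1, h2]

end General

/-- **Theorem 2.5 (ii)** (the optimal coefficient; named fact, DISCHARGED below by
`cechMatomaki2025_theorem25ii_holds`).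
For a finite family with non-negative weights, `β(M) ≥ β(N)`, `Ψ_M Ψ_{N,N} ≠ 0` and
`Ψ_N Ψ_{M,N} ≠ Ψ_M Ψ_{N,N}`: with
`α₁ := (conj(Ψ_M) Ψ_{M,N} − conj(Ψ_N) Ψ_{M,M}) / (conj(Ψ_N) conj(Ψ_{M,N}) − conj(Ψ_M) Ψ_{N,N})`
the maximum over `α ∈ ℂ` of `β(M + αN)` is attained at `α₁` and equals
`β(M) + |conj(Ψ_M)Ψ_{M,N} − conj(Ψ_N)Ψ_{M,M}|² / (Ψ_{M,M}(Ψ_{M,M}Ψ_{N,N} − |Ψ_{M,N}|²))`,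
the denominators being positive. [cite: CechMatomaki2025, Theorem 2.5 (ii)] -/
def _root_.Literature.NumberTheory.LFunctions.cechMatomaki2025_theorem25ii : Prop :=
  ∀ (ι : Type) [Fintype ι] (w : ι → ℝ) (L M N : ι → ℂ), (∀ π, 0 ≤ w π) →
    beta w L N ≤ beta w L M → Psi w L M * (msq w L N : ℂ) ≠ 0 →
    Psi w L N * Psi2 w L M N ≠ Psi w L M * (msq w L N : ℂ) →
      let α₁ : ℂ := (conj (Psi w L M) * Psi2 w L M N - conj (Psi w L N) * (msq w L M : ℂ)) /
        (conj (Psi w L N) * conj (Psi2 w L M N) - conj (Psi w L M) * (msq w L N : ℂ))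
      0 < msq w L M * (msq w L M * msq w L N - ‖Psi2 w L M N‖ ^ 2) ∧
      beta w L (M + α₁ • N) = beta w L M +
        ‖conj (Psi w L M) * Psi2 w L M N - conj (Psi w L N) * (msq w L M : ℂ)‖ ^ 2 /
          (msq w L M * (msq w L M * msq w L N - ‖Psi2 w L M N‖ ^ 2)) ∧
      ∀ α : ℂ, beta w L (M + α • N) ≤ beta w L (M + α₁ • N)

/-- **Theorem 2.5 (ii)**: discharge of the named fact `cechMatomaki2025_theorem25ii` (from the
universe-polymorphic `CechMatomaki2025.theorem25ii`). [cite: CechMatomaki2025, Theorem 2.5 (ii)] -/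
theorem _root_.Literature.NumberTheory.LFunctions.cechMatomaki2025_theorem25ii_holds :
    cechMatomaki2025_theorem25ii :=
  fun _ι _ _w _L _M _N hw hβ hne hneq => CechMatomaki2025.theorem25ii hw hβ hne hneq

/-! ## The Dirichlet-character setting of Theorems 1.1 and 1.3 -/

/-- The mollifier length `⌊X^θ⌋` ("`b ≤ X^θ`"). [cite: CechMatomaki2025, §1] -/
def len (X θ : ℝ) : ℕ := ⌊X ^ θ⌋₊

/-- The Iwaniec–Sarnak weight `1 − log b / log X^θ`. [cite: CechMatomaki2025, §1 (Theorem 1.1)] -/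
def isWeight (X θ : ℝ) (b : ℕ) : ℝ := 1 - Real.log b / Real.log (X ^ θ)

/-- The Iwaniec–Sarnak mollifier `M_IS(χ) = Σ_{b ≤ X^θ} μ(b) χ(b) b^{−1/2} (1 − log b / log X^θ)`
(length parameter `X`: `X = q` in Theorem 1.1, `X = Q` for the averaged family).
[cite: CechMatomaki2025, Theorem 1.1] -/
def mollifierIS (X θ : ℝ) {q : ℕ} (χ : DirichletCharacter ℂ q) : ℂ :=
  ∑ b ∈ Icc 1 (len X θ),
    ((ArithmeticFunction.moebius b : ℤ) : ℂ) * χ (b : ZMod q) / (Real.sqrt b : ℂ) * (isWeight X θ b : ℂ)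

/-- A general one-piece mollifier `N_G(χ) = Σ_{b ≤ X^θ} x_b χ(b) b^{−1/2}`.
[cite: CechMatomaki2025, Theorem 1.1] -/
def mollifierOnePiece (X θ : ℝ) (x : ℕ → ℂ) {q : ℕ} (χ : DirichletCharacter ℂ q) : ℂ :=
  ∑ b ∈ Icc 1 (len X θ), x b * χ (b : ZMod q) / (Real.sqrt b : ℂ)

/-- The root number `ε_χ := τ(χ)/√q`, `τ(χ) = Σ_{t mod q} χ(t) e(t/q)` (normalised Gauss sum;
`:= 0` for the unused modulus `q = 0`). [cite: CechMatomaki2025, §6.1] -/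
def rootNumber {q : ℕ} (χ : DirichletCharacter ℂ q) : ℂ :=
  if hq : q = 0 then 0
  else
    haveI : NeZero q := ⟨hq⟩
    gaussSum χ (ZMod.stdAddChar (N := q)) / (Real.sqrt q : ℂ)

/-- The central value `L(1/2, χ)` as a function on all Dirichlet characters mod `q` (the paper's
`L(χ) := L(1/2, χ)` of Example 2.1; `:= 0` for the unused modulus `q = 0`).
[cite: CechMatomaki2025, §2 Example 2.1] -/
def centralValue (q : ℕ) (χ : DirichletCharacter ℂ q) : ℂ :=
  if hq : q = 0 then 0
  else
    haveI : NeZero q := ⟨hq⟩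
    χ.LFunction (1 / 2)

open scoped Classical in
/-- The indicator weight of the primitive characters mod `q` (the family
`G = {χ mod q : χ primitive}` of Example 2.1 with `w ≡ 1`, as a weight on all characters).
[cite: CechMatomaki2025, §2 Example 2.1] -/
def primitiveWeight (q : ℕ) (χ : DirichletCharacter ℂ q) : ℝ := if χ.IsPrimitive then 1 else 0

/-- `β_q(M)`: the §2 quantity `β(M) = |Ψ_M|²/Ψ_{M,M}` for the family of primitive characters mod `q`
with `L(χ) = L(1/2, χ)`, i.e. `|Σ*_χ L(1/2,χ)M(χ)|² / (φ*(q) · Σ*_χ |L(1/2,χ)M(χ)|²)` with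
`φ*(q)` the number of primitive characters — a PROPORTION in `[0, 1]` (`betaMod_le_one`). The §1
display `|Σ* L M|²/Σ*|L M|²` denotes this normalised ratio (§2: "We generalize the definition of
`β_Q(M)` from the previous section to `β(M) := |Ψ_M|²/Ψ_{M,M}`", `Ψ = 𝔼^w` normalised averages;
with raw sums the §1 ratio would be `φ*(q) β_q(M)` and (1.2) could not read `= 1/(1+1/θ) + o(1)`).
`:= 0` when the denominator vanishes (Lean's `x/0 = 0`, the printed convention).
[cite: CechMatomaki2025, §1 (before Theorem 1.1) and §2 (definition of β)] -/
def betaMod (q : ℕ) (M : DirichletCharacter ℂ q → ℂ) : ℝ :=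
  beta (primitiveWeight q) (centralValue q) M

/-- `β_q(M) ≤ 1` (it is a non-vanishing proportion lower bound; sanity check of the normalisation).
[cite: CechMatomaki2025, §2 (2.1)] -/
theorem betaMod_le_one (q : ℕ) (M : DirichletCharacter ℂ q → ℂ) : betaMod q M ≤ 1 :=
  beta_le_one (fun χ => by unfold primitiveWeight; split_ifs <;> norm_num) M

/-- "`x_b ≪ q^ε` for every `ε > 0`" with a growth budget `C : ℝ → ℝ` fixed in advance:
`|x_b| ≤ C(ε) q^ε` for all `ε > 0` and all `b ≥ 1`. [cite: CechMatomaki2025, Theorem 1.1] -/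
def CoeffBound (C : ℝ → ℝ) (q : ℕ) (x : ℕ → ℂ) : Prop :=
  ∀ ε : ℝ, 0 < ε → ∀ b : ℕ, 1 ≤ b → ‖x b‖ ≤ C ε * (q : ℝ) ^ ε

/-- **Čech–Matomäki 2025, Theorem 1.1** (optimality of the Iwaniec–Sarnak mollifier among
one-piece mollifiers of the same length, NAMED FACT). For `0 < θ < 1/2`:
(i) `β_q(M_IS) = 1/(1 + 1/θ) + o(1)` as `q → ∞` through moduli admitting primitive characters
(`q ≢ 2 (mod 4)`; for `q ≡ 2 (mod 4)` there is no primitive character and `β_q = 0` — the printed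
"`q ≥ 3`" is read along such `q`); (ii) for every growth budget `C`, uniformly over coefficient
sequences `x` with `x_1 = 1` and `|x_b| ≤ C(ε) q^ε` (`ε > 0`, `b ≥ 1`), `β_q(N_G) ≤ 1/(1 + 1/θ) + o(1)`
(valid for every `q`); i.e. "`β_q(N_G) ≤ β_q(M_IS) + o(1) = 1/(1+1/θ) + o(1)`".
Status: preprint claim,
unrefereed (arXiv:2501.12526; zbMATH «Preprint») [claim: CechMatomaki2025, status: under-review].
[cite: CechMatomaki2025, Theorem 1.1] -/
def _root_.Literature.NumberTheory.LFunctions.cechMatomaki2025_theorem11 : Prop :=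
  ∀ θ : ℝ, 0 < θ → θ < 1 / 2 →
    (∀ ε₂ : ℝ, 0 < ε₂ → ∃ q₀ : ℕ, ∀ q : ℕ, q₀ ≤ q → q % 4 ≠ 2 →
        |betaMod q (mollifierIS q θ) - 1 / (1 + 1 / θ)| ≤ ε₂) ∧
    (∀ C : ℝ → ℝ, ∀ ε₂ : ℝ, 0 < ε₂ → ∃ q₀ : ℕ, ∀ q : ℕ, q₀ ≤ q → 3 ≤ q →
        ∀ x : ℕ → ℂ, x 1 = 1 → CoeffBound C q x →
          betaMod q (mollifierOnePiece q θ x) ≤ 1 / (1 + 1 / θ) + ε₂)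

/-! ### The `q`-averaged family of Theorem 1.3 -/

/-- Admissible averaging weights: `Φ ≥ 0` smooth with `supp Φ ⊂ [1/2, 2]` and `Φ(1) ≥ 1`.
[cite: CechMatomaki2025, §1 (before Theorem 1.3)] -/
structure AdmissibleWeight (Φ : ℝ → ℝ) : Prop where
  smooth : ContDiff ℝ ∞ Φ
  nonneg : ∀ x, 0 ≤ Φ x
  one_le : 1 ≤ Φ 1
  support_subset : Function.support Φ ⊆ Set.Icc (1 / 2) 2

/-- The weight `Φ(q/Q) · q/φ(q)` of the modulus `q`. [cite: CechMatomaki2025, §1 (definition of β_Q)] -/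
def modulusWeight (Φ : ℝ → ℝ) (Q : ℝ) (q : ℕ) : ℝ := Φ (q / Q) * q / Nat.totient q

/-- The range of moduli `1 ≤ q ≤ ⌊2Q⌋` carrying the (finitely supported) sum `Σ_{q ≥ 1} Φ(q/Q) …`.
[cite: CechMatomaki2025, §1] -/
def moduli (Q : ℝ) : Finset ℕ := Icc 1 ⌊2 * Q⌋₊

/-- The index type of the `q`-averaged family: pairs `(q, χ)` with `1 ≤ q ≤ ⌊2Q⌋` and `χ` a
Dirichlet character mod `q` (primitivity is carried by the weight). [cite: CechMatomaki2025, §1] -/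
abbrev AvgIndex (Q : ℝ) : Type := (q : moduli Q) × DirichletCharacter ℂ (q : ℕ)

open scoped Classical in
/-- The weight of the averaged family: `w(q, χ) = Φ(q/Q) · q/φ(q)` for primitive `χ mod q`, `0`
otherwise. [cite: CechMatomaki2025, §1 (definition of β_Q)] -/
def avgWeight (Φ : ℝ → ℝ) (Q : ℝ) (i : AvgIndex Q) : ℝ :=
  if i.2.IsPrimitive then modulusWeight Φ Q (i.1 : ℕ) else 0

/-- The objects of the averaged family: `L(q, χ) = L(1/2, χ)`. [cite: CechMatomaki2025, §1] -/
def avgCentralValue (Q : ℝ) (i : AvgIndex Q) : ℂ := centralValue (i.1 : ℕ) i.2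

/-- `β_Q(M)` for a mollifier given modulus by modulus (`M q : DirichletCharacter ℂ q → ℂ`): the §2
quantity `β(M) = |Ψ_M|²/Ψ_{M,M}` for the weighted family `{(q, χ) : χ primitive mod q}`,
`w = Φ(q/Q) q/φ(q)`, `L = L(1/2, χ)`, i.e.
`|Σ_q Φ(q/Q)(q/φ(q)) Σ*_χ L(1/2,χ)M(χ)|² / ((Σ_q Φ(q/Q)(q/φ(q)) φ*(q)) · Σ_q Φ(q/Q)(q/φ(q)) Σ*_χ |L(1/2,χ)M(χ)|²)`
— a proportion in `[0,1]` for `Φ ≥ 0` (`betaAvg_le_one`); the §1 display omits the normalising total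
weight, as for `betaMod`. [cite: CechMatomaki2025, §1 (before Theorem 1.3) and §2 (definition of β)] -/
def betaAvg (Φ : ℝ → ℝ) (Q : ℝ) (M : (q : ℕ) → DirichletCharacter ℂ q → ℂ) : ℝ :=
  beta (avgWeight Φ Q) (avgCentralValue Q) (fun i => M (i.1 : ℕ) i.2)

/-- `β_Q(M) ≤ 1` for a non-negative averaging weight. [cite: CechMatomaki2025, §2 (2.1)] -/
theorem betaAvg_le_one {Φ : ℝ → ℝ} (hΦ : ∀ x, 0 ≤ Φ x) (Q : ℝ)
    (M : (q : ℕ) → DirichletCharacter ℂ q → ℂ) : betaAvg Φ Q M ≤ 1 := by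
  refine beta_le_one (fun i => ?_) _
  unfold avgWeight modulusWeight
  split_ifs
  · exact div_nonneg (mul_nonneg (hΦ _) (Nat.cast_nonneg _)) (Nat.cast_nonneg _)
  · exact le_rfl

/-- The balanced Michel–VanderKam mollifier of length `Q^θ`:
`M_MV(χ) = Σ_{b ≤ Q^θ} μ(b)χ(b)b^{−1/2}(1 − log b/log Q^θ)
          + conj(ε_χ) Σ_{b ≤ Q^θ} μ(b) conj(χ(b)) b^{−1/2}(1 − log b/log Q^θ)`.
[cite: CechMatomaki2025, Theorem 1.3] -/
def mollifierMV (Q θ : ℝ) (q : ℕ) (χ : DirichletCharacter ℂ q) : ℂ :=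
  mollifierIS Q θ χ +
    conj (rootNumber χ) * ∑ b ∈ Icc 1 (len Q θ),
      ((ArithmeticFunction.moebius b : ℤ) : ℂ) * conj (χ (b : ZMod q)) / (Real.sqrt b : ℂ) *
        (isWeight Q θ b : ℂ)

/-- A general Bui-type two-piece mollifier of length `Q^θ` with REAL coefficient arrays `x, y`:
`N_B(χ) = Σ_{ab ≤ Q^θ} x_{a,b} conj(χ(a)) χ(b) (ab)^{−1/2}
        + conj(ε_χ) Σ_{ab ≤ Q^θ} y_{a,b} χ(a) conj(χ(b)) (ab)^{−1/2}`.
[cite: CechMatomaki2025, Theorem 1.3] -/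
def mollifierBui (Q θ : ℝ) (x y : ℕ → ℕ → ℝ) (q : ℕ) (χ : DirichletCharacter ℂ q) : ℂ :=
  (∑ a ∈ Icc 1 (len Q θ), ∑ b ∈ Icc 1 (len Q θ),
      if a * b ≤ len Q θ then
        (x a b : ℂ) * conj (χ (a : ZMod q)) * χ (b : ZMod q) / (Real.sqrt (a * b) : ℂ)
      else 0) +
    conj (rootNumber χ) *
      ∑ a ∈ Icc 1 (len Q θ), ∑ b ∈ Icc 1 (len Q θ),
        if a * b ≤ len Q θ then
          (y a b : ℂ) * χ (a : ZMod q) * conj (χ (b : ZMod q)) / (Real.sqrt (a * b) : ℂ)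
        else 0

open scoped Classical in
/-- `φ⁺(q)`: the number of even primitive characters mod `q`. [cite: CechMatomaki2025, §6.1] -/
def evenPrimitiveCount (q : ℕ) : ℕ :=
  (univ.filter fun χ : DirichletCharacter ℂ q => χ.IsPrimitive ∧ χ.Even).card

/-- The first-moment normalising sum of condition (c):
`Σ_q Φ(q/Q) (q φ⁺(q)/φ(q)) Σ_{k²b ≤ Q^θ, (kb,q)=1} z_{kb,k}/(kb)`.
[cite: CechMatomaki2025, Theorem 1.3 (c)] -/
def normalisingSum (Φ : ℝ → ℝ) (Q θ : ℝ) (z : ℕ → ℕ → ℝ) : ℝ :=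
  ∑ q ∈ moduli Q, Φ (q / Q) * (q * evenPrimitiveCount q / Nat.totient q : ℝ) *
    ∑ k ∈ Icc 1 (len Q θ), ∑ b ∈ Icc 1 (len Q θ),
      if k ^ 2 * b ≤ len Q θ ∧ Nat.Coprime (k * b) q then z (k * b) k / (k * b : ℝ) else 0

/-- `Σ_{ab ≤ Q^θ} |z_{a,b}|²/(ab)` of condition (b). [cite: CechMatomaki2025, Theorem 1.3 (b)] -/
def coeffEnergy (Q θ : ℝ) (z : ℕ → ℕ → ℝ) : ℝ :=
  ∑ a ∈ Icc 1 (len Q θ), ∑ b ∈ Icc 1 (len Q θ),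
    if a * b ≤ len Q θ then z a b ^ 2 / (a * b : ℝ) else 0

/-- Conditions (a), (b), (c) of Theorem 1.3 on `z := x + y`, with the implied-constant data
(`Ca` for (a), `Cb` and the theorem's `c` for (b), `c₁ ≤ c₂` for (c)) explicit.
[cite: CechMatomaki2025, Theorem 1.3 (a)–(c)] -/
def BuiAdmissible (Φ : ℝ → ℝ) (Q θ c : ℝ) (Ca : ℝ → ℝ) (Cb c₁ c₂ : ℝ) (x y : ℕ → ℕ → ℝ) : Prop :=
  let z : ℕ → ℕ → ℝ := fun a b => x a b + y a b
  (∀ ε : ℝ, 0 < ε → ∀ a b : ℕ, 1 ≤ a → 1 ≤ b → |z a b| ≤ Ca ε * Q ^ ε) ∧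
  coeffEnergy Q θ z ≤ Cb * Real.exp (c * Real.log Q ^ (3 / 5 : ℝ) / Real.log (Real.log Q) ^ (1 / 5 : ℝ)) ∧
  (c₁ * Q ^ 2 ≤ |normalisingSum Φ Q θ z| ∧ |normalisingSum Φ Q θ z| ≤ c₂ * Q ^ 2)

/-- **Čech–Matomäki 2025, Theorem 1.3** (the balanced Michel–VanderKam mollifier is optimal
among Bui-type two-piece mollifiers, on average over the modulus; NAMED FACT). For
`0 < θ < 1/2` and an admissible weight `Φ`: (i) `β_Q(M_MV) = 1/(1 + 1/(2θ)) + o(1)`;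
(ii) for every `ε₁ > 0` there is `c = c(ε₁) > 0` such that, for any implied-constant data
`Ca, Cb, 0 < c₁ ≤ c₂` and every `ε₂ > 0`, for all large `Q` and ALL real coefficient arrays `x, y`
satisfying (a), (b) (with this `c`), (c): `β_Q(N_B) ≤ 1/(1 + 1/(2θ)) + ε₁ + ε₂`
("`β_Q(N_B) ≤ β_Q(M_MV) + ε₁ = 1/(1+1/(2θ)) + ε₁ + o(1)`"). The quasi-RH variant (dropping (b))
is not typed. Status: preprint claim,
unrefereed (arXiv:2501.12526; zbMATH «Preprint») [claim: CechMatomaki2025, status: under-review].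
[cite: CechMatomaki2025, Theorem 1.3] -/
def _root_.Literature.NumberTheory.LFunctions.cechMatomaki2025_theorem13 : Prop :=
  ∀ θ : ℝ, 0 < θ → θ < 1 / 2 → ∀ Φ : ℝ → ℝ, AdmissibleWeight Φ →
    (∀ ε₂ : ℝ, 0 < ε₂ → ∃ Q₀ : ℝ, ∀ Q : ℝ, Q₀ ≤ Q →
        |betaAvg Φ Q (fun q χ => mollifierMV Q θ q χ) - 1 / (1 + 1 / (2 * θ))| ≤ ε₂) ∧
    (∀ ε₁ : ℝ, 0 < ε₁ → ∃ c : ℝ, 0 < c ∧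
      ∀ (Ca : ℝ → ℝ) (Cb c₁ c₂ : ℝ), 0 < c₁ → c₁ ≤ c₂ →
        ∀ ε₂ : ℝ, 0 < ε₂ → ∃ Q₀ : ℝ, ∀ Q : ℝ, Q₀ ≤ Q → 3 ≤ Q →
          ∀ x y : ℕ → ℕ → ℝ, BuiAdmissible Φ Q θ c Ca Cb c₁ c₂ x y →
            betaAvg Φ Q (fun q χ => mollifierBui Q θ x y q χ) ≤ 1 / (1 + 1 / (2 * θ)) + ε₁ + ε₂)

/-! ## Bookkeeping (proved): the two ceilings are at most `1/3` resp. `1/2` -/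

/-- The Iwaniec–Sarnak value `1/(1 + 1/θ)` is `< 1/3` for `θ < 1/2` (the "`1/3 − ε`").
[cite: CechMatomaki2025, §1] -/
theorem isValue_lt_third {θ : ℝ} (h₀ : 0 < θ) (h : θ < 1 / 2) : 1 / (1 + 1 / θ) < 1 / 3 := by
  rw [div_lt_div_iff₀ (by positivity) (by norm_num), one_mul, one_mul]
  have : 2 < 1 / θ := by rw [lt_div_iff₀ h₀]; linarith
  linarith

/-- The Michel–VanderKam value `1/(1 + 1/(2θ))` is `< 1/2` for `θ < 1/2`: on average over `q`,
no balanced Bui-type two-piece mollifier reaches the proportion `1/2` (Theorem 1.3).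
[cite: CechMatomaki2025, Theorem 1.3] -/
theorem mvValue_lt_half {θ : ℝ} (h₀ : 0 < θ) (h : θ < 1 / 2) : 1 / (1 + 1 / (2 * θ)) < 1 / 2 := by
  rw [div_lt_div_iff₀ (by positivity) (by norm_num), one_mul, one_mul]
  have : 1 < 1 / (2 * θ) := by rw [lt_div_iff₀ (by positivity)]; linarith
  linarith

/-! ## §4: the mollified moments behind Theorem 1.1 (Propositions 4.1–4.2, named facts)

The four mean values from which Theorem 1.1 is deduced via Theorem 2.4 (q FIXED, sums `Σ⁺` over the
EVEN primitive characters mod `q`, `φ⁺(q)` their number, `L(χ) = L(1/2, χ)`):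
`Ψ_N(q) = Σ⁺ L(χ)N(χ)`, `Ψ_{M,N}(q) = Σ⁺ L(χ)M(χ) conj(L(χ)N(χ))` (4.1), for the Iwaniec–Sarnak
mollifier `M` of length `y₁ = q^θ` and a general one-piece `N` of length `y₂` with coefficients
`x_b ≪ q^ε` (4.2). These are the "`E(d)`-shaped" first/second-moment inputs WITH ARBITRARY
COEFFICIENTS (Proposition 4.1 (i) even allows `θ < 1`). Typed as printed; RENDERING: lengths
`y₂ = q^{θ₂}` (the paper allows any `y₂ ≤ q^θ`, resp. `y₂ ≤ y₁q^{−ε₀}`), `o(·)`/`O(q^{…+ε})` in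
`ε`–`q₀`/`∃K` form, uniform over the admissible coefficient arrays for a fixed implied-constant
function `C` (as in `cechMatomaki2025_theorem11`). -/

open scoped Classical in
/-- `Ψ_N(q) := Σ⁺_{χ mod q} L(1/2,χ) N(χ)` over the even primitive characters (4.1).
[cite: CechMatomaki2025, §4 (4.1)] -/
def PsiPlus (q : ℕ) (N : DirichletCharacter ℂ q → ℂ) : ℂ :=
  ∑ χ : DirichletCharacter ℂ q, if χ.IsPrimitive ∧ χ.Even then centralValue q χ * N χ else 0

open scoped Classical in
/-- `Ψ_{M,N}(q) := Σ⁺_{χ mod q} L(1/2,χ)M(χ) conj(L(1/2,χ)N(χ))` over the even primitive characters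
(4.1). [cite: CechMatomaki2025, §4 (4.1)] -/
def Psi2Plus (q : ℕ) (M N : DirichletCharacter ℂ q → ℂ) : ℂ :=
  ∑ χ : DirichletCharacter ℂ q,
    if χ.IsPrimitive ∧ χ.Even then centralValue q χ * M χ * conj (centralValue q χ * N χ) else 0

/-- `log q / log (q^θ) = 1/θ` (`q > 1`, `θ ≠ 0`): the main-term constant `1 + log q/log y₁` of
Proposition 4.2 at `y₁ = q^θ` is `1 + 1/θ`. [cite: CechMatomaki2025, Proposition 4.2] -/
theorem log_div_log_rpow {q θ : ℝ} (hq : 1 < q) (hθ : θ ≠ 0) :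
    Real.log q / Real.log (q ^ θ) = 1 / θ := by
  have hlog : Real.log q ≠ 0 := Real.log_ne_zero_of_pos_of_ne_one (by linarith) (by linarith)
  rw [Real.log_rpow (by linarith)]
  field_simp

/-- **Proposition 4.1 (i)** (first moment of a general one-piece mollifier, `θ < 1`): `θ ∈ (0,1)`
fixed, `q ≥ 3`, `N(χ) = Σ_{b ≤ q^θ} x_b χ(b) b^{−1/2}` with `x_b ≪_ε q^ε`:
`Ψ_N(q) = φ⁺(q) x₁ + O(q^{θ/2 + 1/2 + ε})` for every `ε > 0`.
Status: preprint claim,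
unrefereed (arXiv:2501.12526; zbMATH «Preprint») [claim: CechMatomaki2025, status: under-review].
[cite: CechMatomaki2025, Proposition 4.1 (i)] -/
def _root_.Literature.NumberTheory.LFunctions.cechMatomaki2025_proposition41i : Prop :=
  ∀ θ : ℝ, 0 < θ → θ < 1 → ∀ C : ℝ → ℝ, ∀ ε : ℝ, 0 < ε → ∃ K : ℝ, ∀ q : ℕ, 3 ≤ q →
    ∀ x : ℕ → ℂ, CoeffBound C q x →
      ‖PsiPlus q (fun χ => mollifierOnePiece q θ x χ) - (evenPrimitiveCount q : ℂ) * x 1‖ ≤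
        K * (q : ℝ) ^ (θ / 2 + 1 / 2 + ε)

/-- **Proposition 4.1 (ii)** (first moment of the Iwaniec–Sarnak mollifier): `θ ∈ (0,1)` fixed,
`q ≥ 3`, `y₁ = q^θ`: `Ψ_{M_IS}(q) = φ⁺(q) + O(q^{θ/2 + 1/2 + ε})` for every `ε > 0`.
Status: preprint claim,
unrefereed (arXiv:2501.12526; zbMATH «Preprint») [claim: CechMatomaki2025, status: under-review].
[cite: CechMatomaki2025, Proposition 4.1 (ii)] -/
def _root_.Literature.NumberTheory.LFunctions.cechMatomaki2025_proposition41ii : Prop :=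
  ∀ θ : ℝ, 0 < θ → θ < 1 → ∀ ε : ℝ, 0 < ε → ∃ K : ℝ, ∀ q : ℕ, 3 ≤ q →
    ‖PsiPlus q (fun χ => mollifierIS q θ χ) - (evenPrimitiveCount q : ℂ)‖ ≤
      K * (q : ℝ) ^ (θ / 2 + 1 / 2 + ε)

/-- **Proposition 4.2 (i)** (the IS mollifier's correlation with any SHORTER general mollifier):
`θ ∈ (0, ½)`, `ε₀ > 0` fixed, `y₁ = q^θ` (so `y₁ ≥ q^{2ε₀}` once `θ ≥ 2ε₀`), `y₂ = q^{θ₂} ≤ y₁q^{−ε₀}`,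
`x_b ≪_ε q^ε`: `Ψ_{M_IS,N}(q) = conj(x₁)(1 + log q/log y₁)φ⁺(q) + o(√(Ψ_{N,N}(q)φ⁺(q)) + φ⁺(q))`.
RENDERING: `θ₂ ≤ θ − ε₀` with `2ε₀ ≤ θ`; `1 + log q/log y₁ = 1 + 1/θ` (`log_div_log_rpow`); the `o` as
`≤ ε(…)` for `q ≥ q₀(θ, θ₂, C, ε)`, uniformly over admissible coefficients; `Ψ_{N,N}(q)` enters through
its norm. Status: preprint claim,
unrefereed (arXiv:2501.12526; zbMATH «Preprint») [claim: CechMatomaki2025, status: under-review].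
[cite: CechMatomaki2025, Proposition 4.2 (i)] -/
def _root_.Literature.NumberTheory.LFunctions.cechMatomaki2025_proposition42i : Prop :=
  ∀ θ : ℝ, 0 < θ → θ < 1 / 2 → ∀ ε₀ : ℝ, 0 < ε₀ → 2 * ε₀ ≤ θ → ∀ θ₂ : ℝ, 0 < θ₂ → θ₂ ≤ θ - ε₀ →
    ∀ C : ℝ → ℝ, ∀ ε : ℝ, 0 < ε → ∃ q₀ : ℕ, ∀ q : ℕ, q₀ ≤ q → ∀ x : ℕ → ℂ, CoeffBound C q x →
      ‖Psi2Plus q (fun χ => mollifierIS q θ χ) (fun χ => mollifierOnePiece q θ₂ x χ) -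
          conj (x 1) * (1 + 1 / θ) * (evenPrimitiveCount q : ℂ)‖ ≤
        ε * (Real.sqrt (‖Psi2Plus q (fun χ => mollifierOnePiece q θ₂ x χ)
              (fun χ => mollifierOnePiece q θ₂ x χ)‖ * evenPrimitiveCount q) + evenPrimitiveCount q)

/-- **Proposition 4.2 (ii)** (second moment of the Iwaniec–Sarnak mollifier; "well-known"):
`θ ∈ (0, ½)`, `y₁ = q^θ`: `Ψ_{M_IS,M_IS}(q) = (1 + log q/log y₁)φ⁺(q) + o(φ⁺(q))`, i.e.
`= (1 + 1/θ)φ⁺(q) + o(φ⁺(q))`, whence `β_q(M_IS) = 1/(1 + 1/θ) + o(1)` with Proposition 4.1 (ii).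
Status: preprint claim,
unrefereed (arXiv:2501.12526; zbMATH «Preprint») [claim: CechMatomaki2025, status: under-review].
[cite: CechMatomaki2025, Proposition 4.2 (ii)] -/
def _root_.Literature.NumberTheory.LFunctions.cechMatomaki2025_proposition42ii : Prop :=
  ∀ θ : ℝ, 0 < θ → θ < 1 / 2 → ∀ ε : ℝ, 0 < ε → ∃ q₀ : ℕ, ∀ q : ℕ, q₀ ≤ q →
    ‖Psi2Plus q (fun χ => mollifierIS q θ χ) (fun χ => mollifierIS q θ χ) -
        (1 + 1 / θ) * (evenPrimitiveCount q : ℂ)‖ ≤ ε * evenPrimitiveCount q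

/-- The Iwaniec–Sarnak value from the two main terms: `|φ⁺|²/((1 + 1/θ)φ⁺) = φ⁺/(1 + 1/θ)`, i.e.
`β = 1/(1+1/θ)` after normalising by `φ⁺` (the deduction "(4.1 (ii)) + (4.2 (ii)) ⇒
`β_q(M_IS) = 1/(1+1/θ) + o(1)`" at the level of main terms). [cite: CechMatomaki2025, §4] -/
theorem isValue_of_mainTerms {θ φ : ℝ} (hθ : 0 < θ) (hφ : 0 < φ) :
    φ ^ 2 / ((1 + 1 / θ) * φ) / φ = 1 / (1 + 1 / θ) := by
  have h1 : (1 + 1 / θ) ≠ 0 := by positivity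
  field_simp

end CechMatomaki2025

end Literature.NumberTheory.LFunctions
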